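import Literature.Computability.AlgebraicComplexity.SmallFormatRank
import Literature.Computability.AlgebraicComplexity.TwoByTwoRankLowerBound
import Mathlib.FieldTheory.IsAlgClosed.AlgebraicClosure
import Mathlib.LinearAlgebra.Quotient.Basic
import Literature.Computability.AlgebraicComplexity.SmallFormatRankLemma7
import Literature.Computability.AlgebraicComplexity.SmallFormatRankChains
import Literature.Computability.AlgebraicComplexity.MatMulRankLowerBoundsBlaserProofs
import HarnessLib

/-!
# `7 ≤ R(⟨2,2,2⟩)` over every field — discharge of the Winograd 1971 named fact

Sibling proof file of `SmallFormatRank.lean`: it discharges the named fact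
`winograd1971_seven_le_tensorRank_matMulTensor_two` (`∀ K field, 7 ≤ tensorRank (matMulTensor K 2 2 2)`;
Winograd 1971, Thm. 3.1: "Every algorithm for multiplying two `2 × 2` matrices requires at least
seven multiplications"; Hopcroft–Kerr 1971) as
`winograd1971_seven_le_tensorRank_matMulTensor_two_holds`, by the theorem
`seven_le_tensorRank_matMulTensor_two` of `TwoByTwoRankLowerBound.lean`, where the proof is
formalised: Baur's proof of Bürgisser–Clausen–Shokrollahi 1997, Prop. (17.9) (`R(A) ≥ 2 dim A − 1`
for a simple algebra `A` over any field), specialised to `A = K^{2×2}`, giving Cor. (17.10)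
"(Hopcroft and Kerr, Winograd). The rank of `k^{2×2}` is equal to `7`" together with Strassen's
upper bound (`tensorRank_matMulTensor_two_le_seven`, hence `tensorRank_matMulTensor_two_eq_seven`).

Kept in a separate file so that `SmallFormatRank.lean` (definitions and named facts) is unchanged.
-/

namespace Literature.Computability.AlgebraicComplexity

/-- **DISCHARGE of `winograd1971_seven_le_tensorRank_matMulTensor_two`** (Winograd 1971,
Thm. 3.1: "Every algorithm for multiplying two `2 × 2` matrices requires at least seven
multiplications"; over every field: Bürgisser–Clausen–Shokrollahi 1997, Cor. (17.10)
(Hopcroft–Kerr, Winograd) from Prop. (17.9), proof by Baur) — the one-line application of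
`seven_le_tensorRank_matMulTensor_two` (`TwoByTwoRankLowerBound.lean`).
[cite: Winograd1971, Thm. 3.1] -/
theorem winograd1971_seven_le_tensorRank_matMulTensor_two_holds :
    winograd1971_seven_le_tensorRank_matMulTensor_two := by
  intro K _
  exact seven_le_tensorRank_matMulTensor_two K

/-- `R(⟨2,2,2⟩) = 7` over every field, unconditionally (Bläser 2003, p. 45; Strassen 1969 for
`≤ 7`, Winograd 1971 / Hopcroft–Kerr 1971 for `≥ 7`): `tensorRank_matMulTensor_two_eq_seven` fed
with the discharged fact. [cite: Blaser2003, p. 45] -/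
theorem tensorRank_matMulTensor_two_eq_seven' (K : Type) [Field K] :
    tensorRank (matMulTensor K 2 2 2) = 7 :=
  tensorRank_matMulTensor_two_eq_seven winograd1971_seven_le_tensorRank_matMulTensor_two_holds K

end Literature.Computability.AlgebraicComplexity

/-!
# Bläser's bound `R(⟨n,m,n⟩) ≥ 2mn + 2n − m − 2` (Bläser 2003, Theorem 14) — the proof

Topic `Literature/Computability/AlgebraicComplexity`. This file discharges the named facts
`blaser2003_thm14` (**Bläser 2003, Theorem 14**: for every field `k` and all `m ≥ n ≥ 3`,
`R(⟨n,m,n⟩) ≥ 2mn + 2n − m − 2`) and `blaser2003_cor9` (**Corollary 9**: `R(⟨3,3,3⟩) ≥ 19`) of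
`SmallFormatRank.lean`, as `blaser2003_thm14_holds` and `blaser2003_cor9_holds`, sorry-free.
It sits on top of the proof files `SmallFormatRankSubstitution` (Def. 1–2, Lemma 3, Extension
Lemma 4), `SmallFormatRankFlag` (the flag `L_η, Z_η, R`, Lemma 5), `SmallFormatRankIsotropic`
(Lemma 6), `SmallFormatRankNormalization` (§3, bridge from `tensorRank`, rows adapted to `a`),
`SmallFormatRankLemma7` (Lemma 7) and `SmallFormatRankChains` (the moves of §5, Lemmas 12–13).

## Content

* `Config β S I D` — the configuration of p. 52, (3)–(4): `D ⊆ I`, `|I| = dim S + n − 2`,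
  `S ⊕ ⟨w_D⟩ = ⟨w_I⟩` with `w_D` independent, `|D| ≤ n − 2`, the `w_i` spanning; `Config.map` /
  `.sandwich` / `.transposed` — its transport under the equivalence transformations of §3;
  `exists_config` — its derivation from Lemma 7 (dual basis, (3), `S = a k^{m×n}`, `G₀`, `I`,
  `d ≤ n − 2`, `D`) with `S = {first n − rk a rows zero}`.
* `caseB_core`, `caseB_false` — the case `rk a = 1` (pp. 58–59; after transposition
  `S = L_{n−1}`): Lemma 13, a projection onto `S`, Lemma 5.
* `caseA_core`, `caseA_false` — the case `rk a ≥ 2` (pp. 56–58): the coordinate changes (5), (6),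
  `W_1`, `W_2`, Lemma 12, Lemma 5.
* `not_bilinComp_short` — no computation of `⟨n,m,n⟩` of length `2mn + 2n − m − 3` over an
  algebraically closed field; `blaser2003_thm14_holds` (base change to the algebraic closure,
  `tensorRank_matMulTensor_map_le`); `blaser2003_cor9_holds`.

## On the printed proof and this formalisation

The argument is Bläser's, step by step, with two systematic simplifications: (i) nothing is ever
renumbered and coordinates are changed only by explicit sandwiching of the computation
(`BilinComp.sandwich`, `BilinComp.transposed`), the configuration being transported along
(`Config.map`); (ii) Lemmas 10 and 11 (bookkeeping of projections) are replaced by the direct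
decompositions `w − p(w) ∈ W_1` for `w ∈ W_1 + L_1`. In the case `rk a ≥ 2` the completion `J₂`
of `π_2(w_{J₁})` is taken in full (the printed `j_{e+1}, …, j_h`), so `≥ 2n − 2` (rather than
exactly `2n − 2`) of the `w_ρ` land in the flag, which only strengthens the application of
Lemma 5 / Lemma 3; the bound `h ≤ 2 rk a + d` gives the `n − 3` further indices.

## References

* M. Bläser, *On the complexity of the multiplication of matrices of small formats*,
  J. Complexity 19 (2003) 43–60: Lemma 7 and (3)–(4) (pp. 50–52), §5 (pp. 53–59), Theorem 14,
  Corollary 9. [Blaser2003]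
-/

namespace Literature.Computability.AlgebraicComplexity

open Module Matrix

variable {k : Type*} [Field k]

/-! ## The configuration reached after (4) (Bläser 2003, pp. 51–52) -/

section Config

variable {m n : ℕ} {ι : Type*} [Fintype ι] [DecidableEq ι]

/-- **The configuration of Bläser 2003, p. 52, (3)–(4).** For a computation `β` of `⟨n,m,n⟩`, a
subspace `S` (there: `S = a k^{m×n}`), and index sets `D ⊆ I` (there: `{i_1, …, i_d} ⊆ I`):
`|I| = dim S + n − 2`, `S ⊕ ⟨w_i | i ∈ D⟩ = ⟨w_i | i ∈ I⟩ = S'` (this is (4), with the `w_i`,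
`i ∈ D`, independent and `d = |D| ≤ n − 2`), and the `w_i` span `k^{n×n}`. The lower bound is
derived from any such configuration with `S` of the shape `{first n − α rows zero}`
(`2 ≤ α ≤ n − 1`) or `L_{n−1}`. [cite: Blaser2003, §4 p. 52] -/
structure Config (β : BilinComp (mulBilin k n m n) ι) (S : Submodule k (Matrix (Fin n) (Fin n) k))
    (I D : Finset ι) : Prop where
  /-- `{i_1, …, i_d} ⊆ I` -/
  D_sub : D ⊆ I
  /-- `#I = dim S + n − 2` -/
  card_I : I.card = finrank k S + n - 2
  /-- (4): `S + ⟨w_{i_1}, …, w_{i_d}⟩ = S'` -/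
  sup_eq : S ⊔ Submodule.span k (β.w '' ↑D) = Submodule.span k (β.w '' ↑I)
  /-- (4): the sum is direct -/
  disj : Disjoint S (Submodule.span k (β.w '' ↑D))
  /-- the `w_i`, `i ∈ D`, are linearly independent -/
  indep : LinearIndepOn k β.w ↑D
  /-- `d ≤ n − 2` -/
  card_D : D.card ≤ n - 2
  /-- `⟨w_1, …, w_r⟩ = k^{n×n}` -/
  span_top : Submodule.span k (Set.range β.w) = ⊤

omit [DecidableEq ι] in
/-- The configuration is transported along any linear automorphism `Φ` of `k^{n×n}` applied to the
`w_i` and to `S` (sandwiching, transposition). [cite: Blaser2003, §3] -/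
theorem Config.map {β β₂ : BilinComp (mulBilin k n m n) ι} {S : Submodule k (Matrix (Fin n) (Fin n) k)}
    {I D : Finset ι} (cfg : Config β S I D)
    (Φ : Matrix (Fin n) (Fin n) k ≃ₗ[k] Matrix (Fin n) (Fin n) k) (hβ₂ : ∀ i, β₂.w i = Φ (β.w i)) :
    Config β₂ (S.map (Φ : Matrix (Fin n) (Fin n) k →ₗ[k] Matrix (Fin n) (Fin n) k)) I D := by
  have hw : β₂.w = Φ ∘ β.w := funext hβ₂
  have hspan : ∀ X : Set ι, Submodule.span k (β₂.w '' X) =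
      (Submodule.span k (β.w '' X)).map (Φ : Matrix (Fin n) (Fin n) k →ₗ[k] _) := by
    intro X; rw [hw, map_span_image]; rfl
  have hinj : Function.Injective (Φ : Matrix (Fin n) (Fin n) k →ₗ[k] Matrix (Fin n) (Fin n) k) :=
    Φ.injective
  refine ⟨cfg.D_sub, ?_, ?_, ?_, ?_, cfg.card_D, ?_⟩
  · rw [LinearEquiv.finrank_map_eq]; exact cfg.card_I
  · rw [hspan, hspan, ← Submodule.map_sup, cfg.sup_eq]
  · rw [hspan, Submodule.disjoint_def]
    intro z hzS hzD
    have : z ∈ (S ⊓ Submodule.span k (β.w '' ↑D)).map (Φ : Matrix (Fin n) (Fin n) k →ₗ[k] _) := by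
      rw [Submodule.map_inf _ hinj]; exact ⟨hzS, hzD⟩
    rw [cfg.disj.eq_bot, Submodule.map_bot] at this
    exact (Submodule.mem_bot k).1 this
  · rw [hw]
    exact cfg.indep.map_injOn _ Φ.injective.injOn
  · rw [hw, Set.range_comp, ← LinearEquiv.coe_coe, Submodule.span_image, cfg.span_top, Submodule.map_top,
      LinearMap.range_eq_top]
    exact Φ.surjective

end Config

/-! ## From Lemma 7 to the configuration (Bläser 2003, p. 52, (3)–(4)) -/

section Setup

variable {m n : ℕ} {ι : Type*} [Fintype ι] [DecidableEq ι]

omit [Fintype ι] in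
/-- Dual bases: if the `g_ρ`, `ρ ∈ G`, have no common zero and `g_ρ(y_μ) = δ_{ρμ}` on `G`, then every
vector is `∑_{μ∈G} g_μ(Y) y_μ` ("let `y_1, …, y_M` denote the dual basis of `g_1, …, g_M`",
Bläser 2003, p. 51). [cite: Blaser2003, §4 p. 51] -/
theorem eq_sum_dual {V : Type*} [AddCommGroup V] [Module k V] (g : ι → Module.Dual k V)
    (G : Finset ι) (hinj : ∀ v, (∀ ρ ∈ G, g ρ v = 0) → v = 0) (y : ι → V)
    (hy : ∀ μ, ∀ ρ ∈ G, g ρ (y μ) = if ρ = μ then 1 else 0) (Y : V) :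
    Y = ∑ μ ∈ G, g μ Y • y μ := by
  have h0 := hinj (Y - ∑ μ ∈ G, g μ Y • y μ) fun ρ hρ => by
    rw [map_sub, map_sum]
    simp_rw [map_smul, smul_eq_mul]
    rw [Finset.sum_eq_single ρ (fun μ _ hμρ => by rw [hy μ ρ hρ, if_neg (Ne.symm hμρ), mul_zero])
      (fun h => absurd hρ h), hy ρ ρ hρ, if_pos rfl, mul_one, sub_self]
  exact (sub_eq_zero.1 h0)

omit [Fintype ι] [DecidableEq ι] in
/-- `dim ⟨w_i | i ∈ X⟩ ≤ |X|`. [folklore] -/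
theorem finrank_span_image_le_card {W : Type*} [AddCommGroup W] [Module k W] (w : ι → W)
    (X : Finset ι) : finrank k (Submodule.span k (w '' ↑X)) ≤ X.card := by
  have : Submodule.span k (w '' ↑X) = Submodule.span k (Set.range fun i : X => w i) := by
    congr 1; ext y; simp
  rw [this]
  have h1 := finrank_range_le_card (R := k) (fun i : X => w i)
  rw [Set.finrank] at h1
  simpa using h1

omit [Fintype ι] [DecidableEq ι] in
/-- `dim ⟨w_i | i ∈ X⟩ = |X|` for an independent family. [folklore] -/
theorem finrank_span_image_eq_card {W : Type*} [AddCommGroup W] [Module k W] (w : ι → W)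
    (X : Finset ι) (h : LinearIndepOn k w ↑X) : finrank k (Submodule.span k (w '' ↑X)) = X.card := by
  have : Submodule.span k (w '' ↑X) = Submodule.span k (Set.range fun i : X => w i) := by
    congr 1; ext y; simp
  rw [this, finrank_span_eq_card (b := fun i : X => w i) h, Fintype.card_coe]

/-- **Bläser 2003, p. 52, (3)–(4): the configuration.** For `m ≥ n ≥ 3`, `k` algebraically closed
and a computation of `⟨n,m,n⟩` of length `2mn + 2n − m − 3` there are a computation `β'` of the same
length, index sets `D ⊆ I` and `1 ≤ α ≤ n − 1` forming a `Config` with `S = {first n − α rows zero}`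
(`= a k^{m×n}` for the matrix `a` of Lemma 7, `α = rk a`). Proof as printed: the dual basis `(y_μ)`;
(3) `a y_μ ∈ ⟨w_μ⟩ + ⟨w_ρ | ρ ∈ E⟩` where `E` is the set of the `n − 2` remaining indices;
`S = a k^{m×n} = ⟨a y_μ⟩`, a basis `a y_μ`, `μ ∈ G₀`, of it, `I = G₀ ∪ E`, `S' = ⟨w_I⟩ ⊇ S`,
`d = dim S' − dim S ≤ n − 2` and indices `D` with `S ⊕ ⟨w_D⟩ = S'`. [cite: Blaser2003, §4 p. 52] -/
theorem exists_config [IsAlgClosed k] (hn : 3 ≤ n) (hnm : n ≤ m)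
    (hcard : Fintype.card ι = 2 * (m * n) + 2 * n - m - 3) (β : BilinComp (mulBilin k n m n) ι) :
    ∃ (β' : BilinComp (mulBilin k n m n) ι) (I D : Finset ι) (α : ℕ), 1 ≤ α ∧ α < n ∧
      Config β' (topZero k n n (n - α)) I D := by
  classical
  obtain ⟨β', G, F, a, hG, hGF, hF, hGinj, hGsurj, ha0, hrank, hFa, haV⟩ :=
    blaser2003_lemma7_adapted (by omega) hnm hcard β
  set α := a.rank with hα
  have hm0 : 0 < m := by omega
  -- `1 ≤ α`
  have hα1 : 1 ≤ α := by
    by_contra hlt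
    have hα0 : α = 0 := by omega
    obtain ⟨i, μ, hiμ⟩ : ∃ i μ, a i μ ≠ 0 := by
      by_contra hall; push Not at hall; exact ha0 (Matrix.ext fun i μ => hall i μ)
    have hn0 : 0 < n := by omega
    have hmem := (haV (a * Matrix.single μ (⟨0, hn0⟩ : Fin n) (1 : k))).1 ⟨_, rfl⟩
    rw [hα0, Nat.sub_zero] at hmem
    have := hmem i ⟨0, hn0⟩ i.isLt
    rw [mul_single_apply', if_pos rfl] at this
    exact hiμ this
  set S : Submodule k (Matrix (Fin n) (Fin n) k) := topZero k n n (n - α) with hS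
  have hSmem : ∀ z, z ∈ S ↔ ∃ y, a * y = z := fun z => (haV z).symm
  -- the dual basis
  have hdual : ∀ μ, ∃ y : Matrix (Fin m) (Fin n) k, ∀ ρ ∈ G, β'.g ρ y = if ρ = μ then 1 else 0 :=
    fun μ => hGsurj fun ρ => if ρ = μ then 1 else 0
  choose y hy using hdual
  -- the remaining indices `E`
  set E := Finset.univ \ (G ∪ F) with hE
  have hEcard : E.card = n - 2 := by
    rw [hE, Finset.card_sdiff_of_subset (Finset.subset_univ _), Finset.card_univ, hcard,
      Finset.card_union_of_disjoint hGF, hG, hF]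
    have : m ≤ m * n := by nlinarith
    have : 2 * m ≤ m * n := by nlinarith
    omega
  -- (3): `a y_μ - f_μ(a) w_μ ∈ ⟨w_ρ | ρ ∈ E⟩`
  have h3 : ∀ μ ∈ G, a * y μ - β'.f μ a • β'.w μ ∈ Submodule.span k (β'.w '' ↑E) := by
    intro μ hμ
    have hexp := β'.map_eq_sum a (y μ)
    rw [mulBilin_apply] at hexp
    rw [hexp, ← Finset.sum_erase_add _ _ (Finset.mem_univ μ), hy μ μ hμ, if_pos rfl, mul_one,
      add_sub_cancel_right]
    refine Submodule.sum_mem _ fun ρ hρ => ?_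
    have hρμ : ρ ≠ μ := Finset.ne_of_mem_erase hρ
    by_cases hρG : ρ ∈ G
    · rw [hy μ ρ hρG, if_neg hρμ]; simp
    · by_cases hρF : ρ ∈ F
      · rw [hFa ρ hρF]; simp
      · have hρE : ρ ∈ E := by
          rw [hE, Finset.mem_sdiff, Finset.mem_union]
          exact ⟨Finset.mem_univ _, fun h => h.elim hρG hρF⟩
        exact Submodule.smul_mem _ _ (Submodule.subset_span ⟨ρ, hρE, rfl⟩)
  -- `S` is spanned by the `a y_μ`
  set ay : ι → Matrix (Fin n) (Fin n) k := fun μ => a * y μ with hay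
  have hSspan : S = Submodule.span k (ay '' ↑G) := by
    apply le_antisymm
    · intro z hz
      obtain ⟨Y, rfl⟩ := (hSmem z).1 hz
      rw [eq_sum_dual β'.g G hGinj y hy Y, Matrix.mul_sum]
      refine Submodule.sum_mem _ fun μ hμ => ?_
      rw [Matrix.mul_smul]
      exact Submodule.smul_mem _ _ (Submodule.subset_span ⟨μ, hμ, rfl⟩)
    · rw [Submodule.span_le]
      rintro _ ⟨μ, _, rfl⟩
      exact (hSmem _).2 ⟨_, rfl⟩
  -- a basis `G₀ ⊆ G` of `S`
  obtain ⟨G₀, hG₀G, -, hG₀span, hG₀li⟩ :=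
    exists_linearIndepOn_extension (linearIndepOn_empty k ay) (Set.empty_subset (G : Set ι))
  set G₀f : Finset ι := (Set.toFinite G₀).toFinset with hG₀f
  have hmemG₀ : ∀ i, i ∈ G₀f ↔ i ∈ G₀ := fun i => (Set.toFinite G₀).mem_toFinset
  have hcoeG₀ : (G₀f : Set ι) = G₀ := by ext i; simp [hmemG₀]
  have hSspan₀ : S = Submodule.span k (ay '' ↑G₀f) := by
    rw [hcoeG₀, hSspan]
    exact le_antisymm (Submodule.span_le.2 hG₀span) (Submodule.span_mono (Set.image_mono hG₀G))
  have hfinS : finrank k S = G₀f.card := by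
    rw [hSspan₀]; exact finrank_span_image_eq_card ay G₀f (by rw [hcoeG₀]; exact hG₀li)
  -- `I = G₀ ∪ E`
  have hG₀E : Disjoint G₀f E := Finset.disjoint_left.2 fun i hi hiE => by
    have hiG : i ∈ G := hG₀G ((hmemG₀ i).1 hi)
    rw [hE, Finset.mem_sdiff, Finset.mem_union] at hiE
    exact hiE.2 (Or.inl hiG)
  set I := G₀f ∪ E with hI
  have hIcard : I.card = finrank k S + n - 2 := by
    rw [hI, Finset.card_union_of_disjoint hG₀E, hfinS, hEcard]
    omega
  have hEI : (E : Set ι) ⊆ I := by rw [hI, Finset.coe_union]; exact Set.subset_union_right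
  have hSle : S ≤ Submodule.span k (β'.w '' ↑I) := by
    rw [hSspan₀, Submodule.span_le]
    rintro _ ⟨μ, hμ, rfl⟩
    have hμG : μ ∈ G := hG₀G ((hmemG₀ μ).1 hμ)
    have h1 : ay μ = (a * y μ - β'.f μ a • β'.w μ) + β'.f μ a • β'.w μ := by simp [hay]
    rw [h1]
    refine Submodule.add_mem _ (Submodule.span_mono (Set.image_mono hEI) (h3 μ hμG))
      (Submodule.smul_mem _ _ (Submodule.subset_span ⟨μ, ?_, rfl⟩))
    rw [hI, Finset.coe_union]
    exact Set.mem_union_left _ hμ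
  -- `D`: indices whose `w_i` form a basis of `S'/S`
  set Qw : ι → (Matrix (Fin n) (Fin n) k ⧸ S) := S.mkQ ∘ β'.w with hQw
  obtain ⟨D₀, hD₀I, -, hD₀span, hD₀li⟩ :=
    exists_linearIndepOn_extension (linearIndepOn_empty k Qw) (Set.empty_subset (I : Set ι))
  set D : Finset ι := (Set.toFinite D₀).toFinset with hD
  have hmemD : ∀ i, i ∈ D ↔ i ∈ D₀ := fun i => (Set.toFinite D₀).mem_toFinset
  have hcoeD : (D : Set ι) = D₀ := by ext i; simp [hmemD]
  have hDI : D ⊆ I := fun i hi => Finset.mem_coe.1 (hD₀I ((hmemD i).1 hi))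
  have hindep : LinearIndepOn k β'.w ↑D := by
    rw [hcoeD]; exact LinearIndepOn.of_comp S.mkQ hD₀li
  have hdisj : Disjoint S (Submodule.span k (β'.w '' ↑D)) := by
    have := disjoint_span_image_ker S.mkQ β'.w D₀ hD₀li
    rw [Submodule.ker_mkQ] at this
    rw [hcoeD]; exact this.symm
  have hsup : S ⊔ Submodule.span k (β'.w '' ↑D) = Submodule.span k (β'.w '' ↑I) := by
    apply le_antisymm
    · exact sup_le hSle (Submodule.span_mono (Set.image_mono (Finset.coe_subset.2 hDI)))
    · rw [Submodule.span_le]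
      rintro _ ⟨i, hi, rfl⟩
      obtain ⟨c, hc, hQc⟩ := exists_mem_span_image_apply_eq S.mkQ β'.w D₀ (hD₀span ⟨i, hi, rfl⟩)
      have hdiff : β'.w i - c ∈ S := by
        rw [← Submodule.ker_mkQ S, LinearMap.mem_ker, map_sub, hQc, sub_self]
      rw [show β'.w i = (β'.w i - c) + c by abel]
      rw [hcoeD]
      exact Submodule.add_mem _ (Submodule.mem_sup_left hdiff) (Submodule.mem_sup_right hc)
  have hcardD : D.card ≤ n - 2 := by
    have h1 : finrank k ↥(S ⊔ Submodule.span k (β'.w '' ↑D) : Submodule k _) ≤ I.card := by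
      rw [hsup]; exact finrank_span_image_le_card β'.w I
    have h2 := Submodule.finrank_sup_add_finrank_inf_eq S (Submodule.span k (β'.w '' ↑D))
    rw [hdisj.eq_bot, finrank_bot, add_zero, finrank_span_image_eq_card β'.w D hindep] at h2
    omega
  refine ⟨β', I, D, α, hα1, hrank, hDI, hIcard, hsup, hdisj, hindep, hcardD, β'.span_w_eq_top hm0⟩

end Setup

/-! ## Sandwiching and transposing a configuration -/

section Glue

variable {m n : ℕ} {ι : Type*} [Fintype ι]

/-- The linear automorphism `z ↦ u z v` of `k^{n×n}` for invertible `u, v`. [cite: Blaser2003, §3] -/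
def sandwichEquiv (u u' v v' : Matrix (Fin n) (Fin n) k) (hu : u * u' = 1) (hu' : u' * u = 1)
    (hv : v' * v = 1) (hv' : v * v' = 1) :
    Matrix (Fin n) (Fin n) k ≃ₗ[k] Matrix (Fin n) (Fin n) k :=
  LinearEquiv.ofLinear ((mulLeftLin k u).comp (mulRightLin k v))
    ((mulLeftLin k u').comp (mulRightLin k v'))
    (by
      ext z : 1
      simp only [LinearMap.comp_apply, mulLeftLin_apply, mulRightLin_apply, LinearMap.id_apply]
      rw [Matrix.mul_assoc, Matrix.mul_assoc, hv, Matrix.mul_one, ← Matrix.mul_assoc, hu,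
        Matrix.one_mul])
    (by
      ext z : 1
      simp only [LinearMap.comp_apply, mulLeftLin_apply, mulRightLin_apply, LinearMap.id_apply]
      rw [Matrix.mul_assoc, Matrix.mul_assoc, hv', Matrix.mul_one, ← Matrix.mul_assoc, hu',
        Matrix.one_mul])

/-- Values of `sandwichEquiv`. [cite: Blaser2003, §3] -/
@[simp] theorem sandwichEquiv_apply (u u' v v' : Matrix (Fin n) (Fin n) k) (hu : u * u' = 1)
    (hu' : u' * u = 1) (hv : v' * v = 1) (hv' : v * v' = 1) (z : Matrix (Fin n) (Fin n) k) :
    sandwichEquiv u u' v v' hu hu' hv hv' z = u * z * v := by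
  simp [sandwichEquiv, Matrix.mul_assoc]

/-- A configuration is preserved by sandwiching, `S ↦ u S v`. [cite: Blaser2003, §3] -/
theorem Config.sandwich {β : BilinComp (mulBilin k n m n) ι}
    {S : Submodule k (Matrix (Fin n) (Fin n) k)} {I D : Finset ι} (cfg : Config β S I D)
    (u u' v v' : Matrix (Fin n) (Fin n) k) (hu : u * u' = 1) (hu' : u' * u = 1)
    (hv : v' * v = 1) (hv' : v * v' = 1) :
    Config (β.sandwich u u' v v' hu hv)
      (S.map (sandwichEquiv u u' v v' hu hu' hv hv' : Matrix (Fin n) (Fin n) k →ₗ[k] _)) I D :=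
  cfg.map (sandwichEquiv u u' v v' hu hu' hv hv') fun i => by simp

/-- A configuration is preserved by transposition, `S ↦ Sᵀ`. [cite: Blaser2003, §3] -/
theorem Config.transposed {β : BilinComp (mulBilin k n m n) ι}
    {S : Submodule k (Matrix (Fin n) (Fin n) k)} {I D : Finset ι} (cfg : Config β S I D) :
    Config β.transposed
      (S.map (Matrix.transposeLinearEquiv (Fin n) (Fin n) k k : Matrix (Fin n) (Fin n) k →ₗ[k] _))
      I D :=
  cfg.map (Matrix.transposeLinearEquiv (Fin n) (Fin n) k k) fun _ => rfl

/-- Right multiplication preserves the row shape `topZero`. [folklore] -/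
theorem mul_mem_topZero {q : ℕ} {z : Matrix (Fin n) (Fin n) k} (hz : z ∈ topZero k n n q)
    (v : Matrix (Fin n) (Fin n) k) : z * v ∈ topZero k n n q := by
  intro i j hi
  rw [Matrix.mul_apply]
  exact Finset.sum_eq_zero fun l _ => by rw [hz i l hi, zero_mul]

/-- Sandwiching with `u ∈ G^q` maps `{first q rows zero}` onto itself ("this does not affect `S`",
Bläser 2003, pp. 56–57). [cite: Blaser2003, §5 p. 57] -/
theorem map_sandwichEquiv_topZero {q : ℕ} (u u' v v' : Matrix (Fin n) (Fin n) k) (hu : u * u' = 1)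
    (hu' : u' * u = 1) (hv : v' * v = 1) (hv' : v * v' = 1) (hutop : IsTopBlock q u) :
    (topZero k n n q).map (sandwichEquiv u u' v v' hu hu' hv hv' : Matrix (Fin n) (Fin n) k →ₗ[k] _) =
      topZero k n n q := by
  apply Submodule.eq_of_le_of_finrank_eq
  · rintro _ ⟨z, hz, rfl⟩
    intro i j hi
    rw [LinearEquiv.coe_coe, sandwichEquiv_apply, Matrix.mul_assoc]
    exact topBlock_mul_apply_eq_zero hutop (z * v) i j hi fun l hl => mul_mem_topZero hz v l j hl
  · exact LinearEquiv.finrank_map_eq _ _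

/-- Sandwiching with a `v` preserving `L_{n−1}` maps `L_{n−1}` onto itself ("`u S v = S`",
Bläser 2003, p. 59). [cite: Blaser2003, §5 p. 59] -/
theorem map_sandwichEquiv_colZero (u u' v v' : Matrix (Fin n) (Fin n) k) (hu : u * u' = 1)
    (hu' : u' * u = 1) (hv : v' * v = 1) (hv' : v * v' = 1)
    (hvL : ∀ z, z ∈ colZero k n n (n - 1) → z * v ∈ colZero k n n (n - 1)) :
    (colZero k n n (n - 1)).map (sandwichEquiv u u' v v' hu hu' hv hv' : Matrix (Fin n) (Fin n) k →ₗ[k] _) =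
      colZero k n n (n - 1) := by
  apply Submodule.eq_of_le_of_finrank_eq
  · rintro _ ⟨z, hz, rfl⟩
    rw [LinearEquiv.coe_coe, sandwichEquiv_apply, Matrix.mul_assoc]
    exact mul_mem_colZero u (hvL z hz)
  · exact LinearEquiv.finrank_map_eq _ _

/-- Transposition maps `{first q rows zero}` onto `L_q`. [folklore] -/
theorem map_transpose_topZero (q : ℕ) :
    (topZero k n n q).map
        (Matrix.transposeLinearEquiv (Fin n) (Fin n) k k : Matrix (Fin n) (Fin n) k →ₗ[k] _) =
      colZero k n n q := by
  ext z
  constructor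
  · rintro ⟨y, hy, rfl⟩
    exact (mem_topZero_iff_transpose_mem_colZero y).1 hy
  · intro hz
    refine ⟨zᵀ, (mem_topZero_iff_transpose_mem_colZero zᵀ).2 (by simpa using hz), ?_⟩
    simp

end Glue

end Literature.Computability.AlgebraicComplexity

namespace Literature.Computability.AlgebraicComplexity

open Module Matrix

variable {k : Type*} [Field k]

/-! ## The case `rk a = 1` (Bläser 2003, pp. 58–59) -/

section CaseB

variable {m n : ℕ} {ι : Type*} [Fintype ι] [DecidableEq ι]

/-- Membership in a bounded supremum from membership in one term. [folklore] -/
theorem mem_biSup_of_mem {E : Type*} [AddCommGroup E] [Module k E] (W : ℕ → Submodule k E)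
    {t τ : ℕ} (hτ : τ ∈ Finset.Icc 1 t) {z : E} (hz : z ∈ W τ) : z ∈ ⨆ τ ∈ Finset.Icc 1 t, W τ :=
  Submodule.mem_iSup_of_mem τ (Submodule.mem_iSup_of_mem hτ hz)

/-- **Bläser 2003, Theorem 14, case `rk a = 1`, core** (p. 58–59, after the coordinates have been
adapted): a configuration with `S = L_{n−1}`, index sets `D_e ⊆ D` and `J` (disjoint from `I`,
`|J| = n − 1 − d`) whose first columns are linearly independent, spanning the first columns of the
`w_i`, `i ∈ D`, by those of `D_e`, and with zeros in the rows `< n − h` of these first columns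
(`h = e + n − 1 − d`), is contradictory: Lemma 13 applied to the projections of the `w_i`,
`i ∈ D ∖ D_e`, a projection `q` onto `S` and `n − 1` further indices `H ⊆ I ∖ D` produce
`2n − 2` of the `w_ρ` inside a flag-adapted `W_1 + ⋯ + W_{t+1}`, so Lemma 5 and Lemma 3 give
`r ≥ 2mn + 2n − m − 2`. [cite: Blaser2003, Theorem 14 (case rk a = 1)] -/
theorem caseB_core (hn : 3 ≤ n) (hcard : Fintype.card ι = 2 * (m * n) + 2 * n - m - 3)
    (β : BilinComp (mulBilin k n m n) ι) (I D De J : Finset ι)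
    (cfg : Config β (colZero k n n (n - 1)) I D) (hDeD : De ⊆ D) (hJI : Disjoint J I)
    (hJcard : J.card = n - 1 - D.card) (he : D.Nonempty → 1 ≤ De.card)
    (hli : LinearIndepOn k (colMap k (⟨0, by omega⟩ : Fin n) ∘ β.w) ↑(De ∪ J))
    (hDespan : ∀ i ∈ D, colMap k (⟨0, by omega⟩ : Fin n) (β.w i) ∈
      Submodule.span k ((colMap k (⟨0, by omega⟩ : Fin n) ∘ β.w) '' ↑De))
    (hP3 : ∀ ρ ∈ De ∪ J, ∀ i : Fin n, (i : ℕ) < n - (De.card + (n - 1 - D.card)) →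
      β.w ρ i ⟨0, by omega⟩ = 0) :
    False := by
  classical
  have hn0 : 0 < n := by omega
  set j0 : Fin n := ⟨0, hn0⟩ with hj0
  set S : Submodule k (Matrix (Fin n) (Fin n) k) := colZero k n n (n - 1) with hS
  set d := D.card with hd
  set e := De.card with he_def
  have hed : e ≤ d := Finset.card_le_card hDeD
  have hdn : d ≤ n - 2 := cfg.card_D
  have hde3 : d - e ≤ n - 3 := by
    by_cases hD : D.Nonempty
    · have := he hD; omega
    · rw [Finset.not_nonempty_iff_eq_empty] at hD
      have : d = 0 := by rw [hd, hD]; rfl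
      omega
  have hfinS : n ≤ finrank k S := by
    have := le_finrank_colZero (k := k) (e := n) (h := n) (q := n - 1) (by omega)
    rwa [show n - (n - 1) = 1 by omega, Nat.mul_one] at this
  -- `W₁`
  set W₁ : Submodule k (Matrix (Fin n) (Fin n) k) := Submodule.span k (β.w '' ↑(De ∪ J)) with hW₁
  have hW₁zero : ∀ z ∈ W₁, ∀ i : Fin n, (i : ℕ) < n - (e + (n - 1 - d)) → z i j0 = 0 := by
    intro z hz i hi
    refine Submodule.span_induction (p := fun z _ => z i j0 = 0) ?_ rfl ?_ ?_ hz
    · rintro _ ⟨ρ, hρ, rfl⟩; exact hP3 ρ hρ i hi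
    · intro y y' _ _ hy hy'; simp [Matrix.add_apply, hy, hy']
    · intro a y _ hy; simp [hy]
  have hW₁disj : Disjoint W₁ (colZero k n n 1) := by
    refine (disjoint_span_image_ker (colMap k j0) β.w ↑(De ∪ J) hli).mono_right fun z hz => ?_
    rw [LinearMap.mem_ker]; funext i; exact hz i j0 (by simp [hj0])
  obtain ⟨p, hpfix, hpkill, hprange⟩ := exists_proj_of_disjoint _ _ hW₁disj
  have hpkillDe : ∀ z ∈ Submodule.span k (β.w '' ↑De), p z = 0 := fun z hz =>
    hpkill z (Submodule.span_mono (Set.image_mono (by simp)) hz)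
  have hdecompD : ∀ i ∈ D, β.w i - p (β.w i) ∈ Submodule.span k (β.w '' ↑De) := by
    intro i hi
    obtain ⟨c, hc, hcol⟩ := exists_mem_span_image_apply_eq (colMap k j0) β.w ↑De (hDespan i hi)
    have hdiff : β.w i - c ∈ colZero k n n 1 := by
      refine mem_colZero_succ hn0 (fun _ _ h => absurd h (Nat.not_lt_zero _)) ?_
      rw [map_sub, hcol, sub_self]
    have : p (β.w i) = β.w i - c := by
      have h1 : p (β.w i - c) = β.w i - c := hpfix _ hdiff
      rw [map_sub, hpkillDe c hc, sub_zero] at h1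
      exact h1
    rw [this, sub_sub_cancel]
    exact hc
  -- the family for Lemma 13
  set Dc := D \ De with hDc
  have hDccard : Dc.card = d - e := by rw [hDc, Finset.card_sdiff_of_subset hDeD]
  let ex := Dc.equivFin
  let x : Fin Dc.card → Matrix (Fin n) (Fin n) k := fun l => p (β.w (ex.symm l))
  have hx1 : ∀ l, x l ∈ colZero k n n 1 := fun l => hprange _
  have hpwD : ∀ i ∈ D, p (β.w i) ∈ Submodule.span k (β.w '' ↑D) := by
    intro i hi
    have h1 : β.w i - (β.w i - p (β.w i)) ∈ Submodule.span k (β.w '' ↑D) :=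
      Submodule.sub_mem _ (Submodule.subset_span ⟨i, hi, rfl⟩)
        (Submodule.span_mono (Set.image_mono (Finset.coe_subset.2 hDeD)) (hdecompD i hi))
    simpa using h1
  have hxdis : Disjoint (Submodule.span k (Set.range x)) (colZero k n n (n - 1)) := by
    refine cfg.disj.symm.mono_left ?_
    rw [Submodule.span_le]
    rintro _ ⟨l, rfl⟩
    exact hpwD _ (Finset.mem_sdiff.1 (ex.symm l).2).1
  obtain ⟨u, u', v, v', hu, hu', hv, hv', hutop, hvfix, hvL, t, W13, ht, hW13, hmem13⟩ :=
    blaser2003_lemma13 Dc.card 1 x (by omega) hx1 hxdis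
  -- the final computation and flag
  set Φ := sandwichEquiv u u' v v' hu hu' hv' hv with hΦ
  set βf := β.sandwich u u' v v' hu hv' with hβf
  have hβfw : ∀ ρ, βf.w ρ = Φ (β.w ρ) := fun ρ => by simp [hβf, hΦ]
  set Wpre : ℕ → Submodule k (Matrix (Fin n) (Fin n) k) := fun τ =>
    if τ = 1 then W₁.map (Φ : Matrix (Fin n) (Fin n) k →ₗ[k] _) else W13 (τ - 1) with hWpre
  have hWpre1 : Wpre 1 = W₁.map (Φ : Matrix (Fin n) (Fin n) k →ₗ[k] _) := by
    show (if (1 : ℕ) = 1 then _ else _) = _; rw [if_pos rfl]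
  have hWpresucc : ∀ τ, 1 ≤ τ → Wpre (τ + 1) = W13 τ := fun τ hτ => by
    show (if τ + 1 = 1 then _ else W13 (τ + 1 - 1)) = _
    rw [if_neg (by omega), Nat.add_sub_cancel]
  -- `Φ W₁ ⊆ Z_1` and `Φ W₁ ∩ L_1 = 0`
  have hcol0 : ∀ z, colMap k j0 (Φ z) = u *ᵥ colMap k j0 z := fun z => by
    rw [hΦ, sandwichEquiv_apply, Matrix.mul_assoc, colMap_mul, colMap_mul_of_fixesCols hvfix j0 (by simp [hj0])]
  have hPre1Z : Wpre 1 ≤ zSub k n n 1 := by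
    rw [hWpre1]
    rintro _ ⟨z, hz, rfl⟩
    refine ⟨fun i j hj => absurd hj (by omega), fun i j hi hj => ?_⟩
    have hj' : j = j0 := Fin.ext (by simp [hj0]; omega)
    subst hj'
    rw [LinearEquiv.coe_coe]
    have h1 : Φ z i j0 = (u *ᵥ colMap k j0 z) i := by
      have := congrFun (hcol0 z) i
      simpa using this
    rw [h1]
    simp only [Matrix.mulVec, dotProduct]
    refine Finset.sum_eq_zero fun l _ => ?_
    by_cases hl : (l : ℕ) < Dc.card + 1
    · rw [colMap_apply, hW₁zero z hz l (by omega), mul_zero]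
    · rw [hutop i l (Or.inr (by omega)), if_neg (by rintro rfl; omega), zero_mul]
  have hPre1L : Disjoint (Wpre 1) (colZero k n n 1) := by
    rw [hWpre1, Submodule.disjoint_def]
    rintro _ ⟨z, hz, rfl⟩ hzL
    have hcol : colMap k j0 z = 0 := by
      have h1 : colMap k j0 (Φ z) = 0 := funext fun i => hzL i j0 (by simp [hj0])
      rw [hcol0] at h1
      exact mulVec_injective_of_mul_eq_one hu' (by rw [h1, Matrix.mulVec_zero])
    have hz0 : z = 0 := Submodule.disjoint_def.1
      (disjoint_span_image_ker (colMap k j0) β.w ↑(De ∪ J) hli) z hz (LinearMap.mem_ker.2 hcol)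
    simp [hz0]
  -- the flag conditions on `Wpre`
  have hPreZ : ∀ τ, 1 ≤ τ → τ ≤ t + 1 → Wpre τ ≤ zSub k n n (0 + τ) := by
    intro τ h1 h2
    rcases Nat.lt_or_ge 1 τ with hτ | hτ
    · obtain ⟨τ', rfl⟩ : ∃ τ', τ = τ' + 1 := ⟨τ - 1, by omega⟩
      rw [hWpresucc τ' (by omega), show 0 + (τ' + 1) = 1 + τ' by omega]
      exact (hW13 τ' (by omega) (by omega)).1
    · have : τ = 1 := by omega
      subst this; simpa using hPre1Z
  have hPreL : ∀ τ, 1 ≤ τ → τ ≤ t + 1 → Disjoint (Wpre τ) (colZero k n n (0 + τ)) := by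
    intro τ h1 h2
    rcases Nat.lt_or_ge 1 τ with hτ | hτ
    · obtain ⟨τ', rfl⟩ : ∃ τ', τ = τ' + 1 := ⟨τ - 1, by omega⟩
      rw [hWpresucc τ' (by omega), show 0 + (τ' + 1) = 1 + τ' by omega]
      exact (hW13 τ' (by omega) (by omega)).2
    · have : τ = 1 := by omega
      subst this; simpa using hPre1L
  set Wstar : Submodule k (Matrix (Fin n) (Fin n) k) := ⨆ τ ∈ Finset.Icc 1 (t + 1), Wpre τ with hWstar
  have hWstarS : Disjoint Wstar S := by
    have h1 := disjoint_biSup_colZero (t + 1) 0 Wpre hPreZ hPreL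
    rw [Nat.zero_add] at h1
    exact h1.mono_right (colZero_antitone n n (by omega))
  obtain ⟨q, hqfix, hqkill, hqrange⟩ := exists_proj_of_disjoint _ _ hWstarS
  -- what lies in `Wstar`
  have hΦDe : ∀ i ∈ De ∪ J, Φ (β.w i) ∈ Wstar := fun i hi =>
    mem_biSup_of_mem Wpre (τ := 1) (Finset.mem_Icc.2 ⟨le_rfl, by omega⟩)
      (by rw [hWpre1]; exact ⟨_, Submodule.subset_span ⟨i, hi, rfl⟩, rfl⟩)
  have hΦsub : ∀ i ∈ D, Φ (β.w i - p (β.w i)) ∈ Wstar := fun i hi =>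
    mem_biSup_of_mem Wpre (τ := 1) (Finset.mem_Icc.2 ⟨le_rfl, by omega⟩) (by
      rw [hWpre1]
      exact ⟨_, Submodule.span_mono (Set.image_mono (by simp)) (hdecompD i hi), rfl⟩)
  have hΦp : ∀ i (hi : i ∈ Dc), Φ (p (β.w i)) ∈ Wstar := by
    intro i hi
    have hmem := hmem13 (ex ⟨i, hi⟩)
    have hxi : x (ex ⟨i, hi⟩) = p (β.w i) := by simp [x]
    rw [hxi] at hmem
    have hΦeq : Φ (p (β.w i)) = u * p (β.w i) * v := by rw [hΦ, sandwichEquiv_apply]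
    rw [hΦeq]
    refine biSup_induction W13 (motive := fun y => y ∈ Wstar) hmem (fun τ hτ y hy => ?_)
      (Submodule.zero_mem _) (fun y y' hy hy' => Submodule.add_mem _ hy hy')
    obtain ⟨hτ1, hτ2⟩ := Finset.mem_Icc.1 hτ
    exact mem_biSup_of_mem Wpre (τ := τ + 1) (Finset.mem_Icc.2 ⟨by omega, by omega⟩)
      (by rw [hWpresucc τ hτ1]; exact hy)
  have hΦD : ∀ i ∈ D, Φ (β.w i) ∈ Wstar := by
    intro i hi
    by_cases hiDe : i ∈ De
    · exact hΦDe i (Finset.mem_union_left _ hiDe)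
    · have : Φ (β.w i) = Φ (β.w i - p (β.w i)) + Φ (p (β.w i)) := by
        rw [← map_add, sub_add_cancel]
      rw [this]
      exact Submodule.add_mem _ (hΦsub i hi) (hΦp i (Finset.mem_sdiff.2 ⟨hi, hiDe⟩))
  have hΦspanD : ∀ z ∈ Submodule.span k (β.w '' ↑D), Φ z ∈ Wstar := by
    intro z hz
    have : Submodule.span k (β.w '' ↑D) ≤ Wstar.comap (Φ : Matrix (Fin n) (Fin n) k →ₗ[k] _) := by
      rw [Submodule.span_le]
      rintro _ ⟨i, hi, rfl⟩
      exact hΦD i hi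
    exact this hz
  -- `H`: `n - 1` indices of `I \\ D`
  have hHex : n - 1 ≤ (I \ D).card := by
    rw [Finset.card_sdiff_of_subset cfg.D_sub, cfg.card_I]; omega
  obtain ⟨H, hHsub, hHcard⟩ := Finset.exists_subset_card_eq hHex
  set Wlast : Submodule k (Matrix (Fin n) (Fin n) k) :=
    Submodule.span k ((fun ρ => q (Φ (β.w ρ))) '' ↑H) with hWlast
  have hWlastS : Wlast ≤ S := Submodule.span_le.2 (by rintro _ ⟨ρ, _, rfl⟩; exact hqrange _)
  have hWlastdim : finrank k Wlast < n := by
    have := finrank_span_image_le_card (k := k) (fun ρ => q (Φ (β.w ρ))) H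
    rw [hHcard] at this
    exact lt_of_le_of_lt this (by omega)
  have hΦH : ∀ ρ ∈ H, Φ (β.w ρ) - q (Φ (β.w ρ)) ∈ Wstar := by
    intro ρ hρ
    have hρI : ρ ∈ I := (Finset.mem_sdiff.1 (hHsub hρ)).1
    have hwI : β.w ρ ∈ S ⊔ Submodule.span k (β.w '' ↑D) := by
      rw [cfg.sup_eq]; exact Submodule.subset_span ⟨ρ, hρI, rfl⟩
    obtain ⟨sS, hsS, wD, hwD, hsum⟩ := Submodule.mem_sup.1 hwI
    rw [← hsum, map_add, map_add]
    have hΦsS : Φ sS ∈ S := by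
      have h1 : Φ sS ∈ S.map (Φ : Matrix (Fin n) (Fin n) k →ₗ[k] Matrix (Fin n) (Fin n) k) :=
        ⟨sS, hsS, rfl⟩
      rwa [hS, hΦ, map_sandwichEquiv_colZero u u' v v' hu hu' hv' hv hvL] at h1
    rw [hqfix _ hΦsS, hqkill _ (hΦspanD wD hwD)]
    simpa using hΦspanD wD hwD
  -- the flag for Lemma 5
  set Wf : ℕ → Submodule k (Matrix (Fin n) (Fin n) k) := fun τ =>
    if τ = t + 2 then Wlast else Wpre τ with hWf
  have hWftop : Wf (t + 2) = Wlast := by show (if t + 2 = t + 2 then _ else _) = _; rw [if_pos rfl]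
  have hWfpre : ∀ τ, τ ≤ t + 1 → Wf τ = Wpre τ := fun τ hτ => by
    show (if τ = t + 2 then _ else _) = _; rw [if_neg (by omega)]
  have hmemWf_of_star : ∀ z ∈ Wstar, z ∈ ⨆ τ ∈ Finset.Icc 1 (t + 2), Wf τ := by
    intro z hz
    refine biSup_induction Wpre (motive := fun y => y ∈ ⨆ τ ∈ Finset.Icc 1 (t + 2), Wf τ) hz
      (fun τ hτ y hy => ?_) (Submodule.zero_mem _) (fun y y' hy hy' => Submodule.add_mem _ hy hy')
    obtain ⟨hτ1, hτ2⟩ := Finset.mem_Icc.1 hτ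
    exact mem_biSup_of_mem Wf (τ := τ) (Finset.mem_Icc.2 ⟨hτ1, by omega⟩)
      (by rw [hWfpre τ hτ2]; exact hy)
  have hmemWf_of_last : ∀ z ∈ Wlast, z ∈ ⨆ τ ∈ Finset.Icc 1 (t + 2), Wf τ := fun z hz =>
    mem_biSup_of_mem Wf (τ := t + 2) (Finset.mem_Icc.2 ⟨by omega, le_rfl⟩) (by rw [hWftop]; exact hz)
  -- the set of indices whose `w` lies in the flag
  set N := (De ∪ J) ∪ Dc ∪ H with hN
  have hNmem : ∀ ρ ∈ N, βf.w ρ ∈ ⨆ τ ∈ Finset.Icc 1 (t + 2), Wf τ := by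
    intro ρ hρ
    rw [hβfw]
    rcases Finset.mem_union.1 hρ with hρ | hρ
    · rcases Finset.mem_union.1 hρ with hρ | hρ
      · exact hmemWf_of_star _ (hΦDe ρ hρ)
      · exact hmemWf_of_star _ (hΦD ρ (Finset.mem_sdiff.1 hρ).1)
    · have : Φ (β.w ρ) = q (Φ (β.w ρ)) + (Φ (β.w ρ) - q (Φ (β.w ρ))) := by abel
      rw [this]
      exact Submodule.add_mem _ (hmemWf_of_last _ (Submodule.subset_span ⟨ρ, hρ, rfl⟩))
        (hmemWf_of_star _ (hΦH ρ hρ))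
  have hNcard : N.card = 2 * n - 2 := by
    have hDeJ : Disjoint De J := Finset.disjoint_left.2 fun i hi hiJ =>
      Finset.disjoint_left.1 hJI hiJ (cfg.D_sub (hDeD hi))
    have h1 : Disjoint (De ∪ J) Dc := Finset.disjoint_left.2 fun i hi hiDc => by
      rcases Finset.mem_union.1 hi with hi | hi
      · exact (Finset.mem_sdiff.1 hiDc).2 hi
      · exact Finset.disjoint_left.1 hJI hi (cfg.D_sub (Finset.mem_sdiff.1 hiDc).1)
    have h2 : Disjoint (De ∪ J ∪ Dc) H := Finset.disjoint_left.2 fun i hi hiH => by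
      have hiD : i ∉ D := (Finset.mem_sdiff.1 (hHsub hiH)).2
      have hiI : i ∈ I := (Finset.mem_sdiff.1 (hHsub hiH)).1
      rcases Finset.mem_union.1 hi with hi | hi
      · rcases Finset.mem_union.1 hi with hi | hi
        · exact hiD (hDeD hi)
        · exact Finset.disjoint_left.1 hJI hi hiI
      · exact hiD (Finset.mem_sdiff.1 hi).1
    rw [hN, Finset.card_union_of_disjoint h2, Finset.card_union_of_disjoint h1,
      Finset.card_union_of_disjoint hDeJ]
    omega
  -- Lemma 5
  have hbound := blaser2003_lemma5_card βf hn0 (t := t + 2) (by omega) (by omega) Wf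
    (fun τ h1 h2 => by rw [hWfpre τ (by omega)]; simpa using hPreZ τ h1 (by omega))
    (fun τ h1 h2 => by rw [hWfpre τ (by omega)]; simpa using hPreL τ h1 (by omega))
    (by rw [hWftop]; exact hWlastS.trans (colZero_antitone n n (by omega)))
    (by rw [hWftop]; exact hWlastdim) N hNmem
  rw [hNcard, hcard, Nat.mul_comm n m, Nat.mul_sub_one] at hbound
  have : m ≤ m * n := by nlinarith
  have : 3 * m ≤ m * n := by nlinarith
  omega

/-- The first-column map is onto. [folklore] -/
theorem colMap_surjective (j : Fin n) : Function.Surjective (colMap k j) := by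
  intro t
  refine ⟨Matrix.of fun i j' => if j' = j then t i else 0, funext fun i => by simp⟩

/-- **Bläser 2003, Theorem 14, case `rk a = 1`** (pp. 58–59): a configuration with `S = L_{n−1}`
is contradictory. The preparatory moves of the printed proof: a permutation of the columns making
a first column of some `w_i`, `i ∈ D`, non-zero (so `e > 0` if `d > 0`); indices `D_e ⊆ D` whose
first columns form a basis of those of `⟨w_D⟩`, and `n − 1 − d` indices `J ∉ I` extending them
independently; row operations putting zeros into the rows `< n − h` of these first columns. Then
`caseB_core`. [cite: Blaser2003, Theorem 14 (case rk a = 1)] -/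
theorem caseB_false (hn : 3 ≤ n) (hcard : Fintype.card ι = 2 * (m * n) + 2 * n - m - 3)
    (β : BilinComp (mulBilin k n m n) ι) (I D : Finset ι)
    (cfg : Config β (colZero k n n (n - 1)) I D) : False := by
  classical
  have hn0 : 0 < n := by omega
  set j0 : Fin n := ⟨0, hn0⟩ with hj0
  set S : Submodule k (Matrix (Fin n) (Fin n) k) := colZero k n n (n - 1) with hS
  -- B1: make a first column of some `w_i`, `i ∈ D`, non-zero
  obtain ⟨β₁, cfg₁, hB1⟩ : ∃ β₁ : BilinComp (mulBilin k n m n) ι, Config β₁ S I D ∧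
      (D.Nonempty → ∃ i ∈ D, colMap k j0 (β₁.w i) ≠ 0) := by
    by_cases hD : D.Nonempty
    · obtain ⟨i₁, hi₁⟩ := hD
      have hw0 : β.w i₁ ≠ 0 := cfg.indep.ne_zero (Finset.mem_coe.2 hi₁)
      have hwS : β.w i₁ ∉ S := fun hmem =>
        hw0 (Submodule.disjoint_def.1 cfg.disj _ hmem (Submodule.subset_span ⟨i₁, hi₁, rfl⟩))
      obtain ⟨i', j, hj, hwij⟩ : ∃ i' j : Fin n, (j : ℕ) < n - 1 ∧ β.w i₁ i' j ≠ 0 := by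
        by_contra hall; push Not at hall
        exact hwS fun i' j hj => hall i' j hj
      set v₀ := swapMatrix k j0 j with hv₀
      have hv₀v₀ : v₀ * v₀ = 1 := swapMatrix_mul_self j0 j
      have hv₀L : ∀ z, z ∈ colZero k n n (n - 1) → z * v₀ ∈ colZero k n n (n - 1) :=
        fun z hz => mul_swapMatrix_mem_colZero (by simp [hj0]; omega) (by omega) hz
      refine ⟨β.sandwich 1 1 v₀ v₀ (Matrix.one_mul 1) hv₀v₀, ?_, fun _ => ⟨i₁, hi₁, ?_⟩⟩
      · have h := cfg.sandwich 1 1 v₀ v₀ (Matrix.one_mul 1) (Matrix.one_mul 1) hv₀v₀ hv₀v₀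
        rwa [hS, map_sandwichEquiv_colZero 1 1 v₀ v₀ _ _ hv₀v₀ hv₀v₀ hv₀L] at h
      · intro h0
        have := congrFun h0 i'
        simp only [BilinComp.sandwich_w, Matrix.one_mul, hv₀, colMap_apply, mul_swapMatrix_apply,
          Equiv.swap_apply_left, Pi.zero_apply] at this
        exact hwij this
    · exact ⟨β, cfg, fun h => absurd h hD⟩
  clear cfg
  -- B2: the index sets `D_e` and `J`
  set c : ι → (Fin n → k) := colMap k j0 ∘ β₁.w with hc
  obtain ⟨De₀, hDe₀D, -, hDe₀span, hDe₀li⟩ :=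
    exists_linearIndepOn_extension (linearIndepOn_empty k c) (Set.empty_subset (D : Set ι))
  set Def : Finset ι := (Set.toFinite De₀).toFinset with hDef
  have hmemDe : ∀ i, i ∈ Def ↔ i ∈ De₀ := fun i => (Set.toFinite De₀).mem_toFinset
  have hcoeDe : (Def : Set ι) = De₀ := by ext i; simp [hmemDe]
  have hDeD : Def ⊆ D := fun i hi => Finset.mem_coe.1 (hDe₀D ((hmemDe i).1 hi))
  have he : D.Nonempty → 1 ≤ Def.card := by
    intro hD
    obtain ⟨i, hi, hci⟩ := hB1 hD
    rw [Nat.one_le_iff_ne_zero]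
    intro h0
    have hemp : De₀ = ∅ := by rw [← hcoeDe, Finset.card_eq_zero.1 h0]; simp
    have := hDe₀span ⟨i, hi, rfl⟩
    rw [hemp, Set.image_empty, Submodule.span_empty] at this
    exact hci (by simpa [hc] using this)
  obtain ⟨B, -, hDe₀B, hBspan, hBli⟩ := exists_linearIndepOn_extension hDe₀li (Set.subset_univ De₀)
  set Bf : Finset ι := (Set.toFinite B).toFinset with hBf
  have hmemB : ∀ i, i ∈ Bf ↔ i ∈ B := fun i => (Set.toFinite B).mem_toFinset
  have hcoeB : (Bf : Set ι) = B := by ext i; simp [hmemB]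
  -- all first columns span `k^n`, so `|B| = n`
  have hcspan : Submodule.span k (Set.range c) = ⊤ := by
    rw [hc, Set.range_comp, Submodule.span_image, cfg₁.span_top, Submodule.map_top,
      LinearMap.range_eq_top]
    exact colMap_surjective j0
  have hBcard : Bf.card = n := by
    have h1 : finrank k (Submodule.span k (c '' ↑Bf)) = Bf.card :=
      finrank_span_image_eq_card c Bf (by rw [hcoeB]; exact hBli)
    have h2 : Submodule.span k (c '' ↑Bf) = ⊤ := by
      apply le_antisymm le_top
      rw [← hcspan, Submodule.span_le]
      rintro _ ⟨i, rfl⟩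
      rw [hcoeB]
      exact hBspan ⟨i, Set.mem_univ _, rfl⟩
    rw [h2, finrank_top, finrank_fintype_fun_eq_card, Fintype.card_fin] at h1
    exact h1.symm
  -- the first columns of the `w_i`, `i ∈ I`, lie in the span of those of `D_e`
  have hIspan : ∀ i ∈ I, c i ∈ Submodule.span k (c '' ↑Def) := by
    intro i hi
    have hwI : β₁.w i ∈ S ⊔ Submodule.span k (β₁.w '' ↑D) := by
      rw [cfg₁.sup_eq]; exact Submodule.subset_span ⟨i, hi, rfl⟩
    obtain ⟨sS, hsS, wD, hwD, hsum⟩ := Submodule.mem_sup.1 hwI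
    have hcsS : colMap k j0 sS = 0 := funext fun i' => hsS i' j0 (by simp [hj0]; omega)
    have hcw : c i = colMap k j0 wD := by
      simp only [hc, Function.comp_apply]
      rw [← hsum, map_add, hcsS, zero_add]
    rw [hcw]
    have h1 : colMap k j0 wD ∈ (Submodule.span k (β₁.w '' ↑D)).map (colMap k j0) := ⟨wD, hwD, rfl⟩
    rw [map_span_image] at h1
    rw [hcoeDe]
    exact (Submodule.span_le.2 hDe₀span) h1
  have hBIcard : (Bf ∩ I).card ≤ Def.card := by
    have h1 : finrank k (Submodule.span k (c '' ↑(Bf ∩ I))) = (Bf ∩ I).card :=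
      finrank_span_image_eq_card c (Bf ∩ I)
        (hBli.mono (by rw [← hcoeB]; exact Finset.coe_subset.2 Finset.inter_subset_left))
    have h2 : Submodule.span k (c '' ↑(Bf ∩ I)) ≤ Submodule.span k (c '' ↑Def) := by
      rw [Submodule.span_le]
      rintro _ ⟨i, hi, rfl⟩
      exact hIspan i (Finset.mem_inter.1 hi).2
    have h3 := Submodule.finrank_mono h2
    have h4 := finrank_span_image_le_card (k := k) c Def
    omega
  have hed : Def.card ≤ D.card := Finset.card_le_card hDeD
  have hJex : n - 1 - D.card ≤ (Bf \ I).card := by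
    have := Finset.card_sdiff_add_card_inter Bf I
    omega
  obtain ⟨J, hJsub, hJcard⟩ := Finset.exists_subset_card_eq hJex
  have hJI : Disjoint J I := Finset.disjoint_left.2 fun i hi => (Finset.mem_sdiff.1 (hJsub hi)).2
  have hDeJB : (↑(Def ∪ J) : Set ι) ⊆ B := by
    rw [Finset.coe_union]
    refine Set.union_subset (by rw [hcoeDe]; exact hDe₀B) fun i hi => ?_
    exact (hmemB i).1 (Finset.mem_sdiff.1 (hJsub hi)).1
  have hli : LinearIndepOn k c ↑(Def ∪ J) := hBli.mono hDeJB
  have hDespan : ∀ i ∈ D, c i ∈ Submodule.span k (c '' ↑Def) := fun i hi =>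
    hIspan i (cfg₁.D_sub hi)
  -- B3: rows adapted to the first columns of `D_e ∪ J`
  set hB := Def.card + (n - 1 - D.card) with hhB
  have hDeJcard : (Def ∪ J).card = hB := by
    rw [Finset.card_union_of_disjoint (Finset.disjoint_left.2 fun i hi hiJ =>
      Finset.disjoint_left.1 hJI hiJ (cfg₁.D_sub (hDeD hi))), hJcard]
  set D₃ : Submodule k (Fin n → k) := Submodule.span k (c '' ↑(Def ∪ J)) with hD₃
  have hD₃dim : finrank k D₃ = hB := by rw [hD₃, finrank_span_image_eq_card c _ hli, hDeJcard]
  obtain ⟨L₃, hL₃⟩ := exists_linearEquiv_adapted D₃ hD₃dim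
  set u₃ := LinearMap.toMatrix' L₃.toLinearMap with hu₃_def
  set u₃' := LinearMap.toMatrix' L₃.symm.toLinearMap with hu₃'_def
  have hu₃ : u₃ * u₃' = 1 := toMatrix'_mul_toMatrix'_symm L₃
  have hu₃' : u₃' * u₃ = 1 := toMatrix'_symm_mul_toMatrix' L₃
  set β₃ := β₁.sandwich u₃ u₃' 1 1 hu₃ (Matrix.one_mul 1) with hβ₃
  have cfg₃ : Config β₃ S I D := by
    have h := cfg₁.sandwich u₃ u₃' 1 1 hu₃ hu₃' (Matrix.one_mul 1) (Matrix.one_mul 1)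
    rwa [hS, map_sandwichEquiv_colZero u₃ u₃' 1 1 hu₃ hu₃' _ _ (fun z hz => by rwa [Matrix.mul_one])] at h
  have hw₃ : ∀ ρ, β₃.w ρ = u₃ * β₁.w ρ := fun ρ => by simp [hβ₃]
  have hc₃ : ∀ ρ, colMap k j0 (β₃.w ρ) = u₃ *ᵥ c ρ := fun ρ => by
    rw [hw₃, colMap_mul]; rfl
  have hc₃' : colMap k j0 ∘ β₃.w = u₃.mulVecLin ∘ c := funext fun ρ => by
    simp only [Function.comp_apply, Matrix.mulVecLin_apply]; exact hc₃ ρ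
  have hli₃ : LinearIndepOn k (colMap k j0 ∘ β₃.w) ↑(Def ∪ J) := by
    rw [hc₃']
    exact hli.map_injOn _ (mulVec_injective_of_mul_eq_one hu₃').injOn
  have hDespan₃ : ∀ i ∈ D, colMap k j0 (β₃.w i) ∈
      Submodule.span k ((colMap k j0 ∘ β₃.w) '' ↑Def) := by
    intro i hi
    rw [hc₃', ← map_span_image, hc₃]
    exact ⟨c i, hDespan i hi, rfl⟩
  have hP3 : ∀ ρ ∈ Def ∪ J, ∀ i : Fin n, (i : ℕ) < n - hB → β₃.w ρ i j0 = 0 := by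
    intro ρ hρ i hi
    have h1 : β₃.w ρ i j0 = (u₃ *ᵥ c ρ) i := by rw [← hc₃]; rfl
    rw [h1, hu₃_def, LinearMap.toMatrix'_mulVec]
    exact (hL₃ (c ρ)).1 (Submodule.subset_span ⟨ρ, hρ, rfl⟩) i hi
  exact caseB_core hn hcard β₃ I D Def J cfg₃ hDeD hJI hJcard he hli₃ hDespan₃ hP3

end CaseB

end Literature.Computability.AlgebraicComplexity

namespace Literature.Computability.AlgebraicComplexity

open Module Matrix

variable {k : Type*} [Field k]

/-! ## The case `rk a ≥ 2` (Bläser 2003, pp. 56–58) -/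

section CaseA

variable {m n : ℕ} {ι : Type*} [Fintype ι] [DecidableEq ι]

/-- The first two columns of a matrix (`π_2 : k^{n×n} → k^{n×n}/L_2`, Bläser 2003, p. 56).
[cite: Blaser2003, §5 p. 56] -/
def firstTwo (k : Type*) [Field k] {n : ℕ} (hn : 2 ≤ n) :
    Matrix (Fin n) (Fin n) k →ₗ[k] Matrix (Fin n) (Fin 2) k where
  toFun z := Matrix.of fun i j => z i ⟨j, by omega⟩
  map_add' _ _ := rfl
  map_smul' _ _ := rfl

/-- Values of `firstTwo`. [cite: Blaser2003, §5 p. 56] -/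
@[simp] theorem firstTwo_apply {n : ℕ} (hn : 2 ≤ n) (z : Matrix (Fin n) (Fin n) k) (i : Fin n)
    (j : Fin 2) : firstTwo k hn z i j = z i ⟨j, by omega⟩ := rfl

/-- `π_2 z = 0` iff `z ∈ L_2`. [cite: Blaser2003, §5 p. 56] -/
theorem firstTwo_eq_zero_iff {n : ℕ} (hn : 2 ≤ n) (z : Matrix (Fin n) (Fin n) k) :
    firstTwo k hn z = 0 ↔ z ∈ colZero k n n 2 := by
  constructor
  · intro h i j hj
    have := congrFun (congrFun h i) ⟨j, hj⟩
    simpa using this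
  · intro h
    ext i j
    simpa using h i ⟨j, by omega⟩ j.isLt

/-- The first column of an `n × 2` matrix. [folklore] -/
def colOfTwo (k : Type*) [Field k] {n : ℕ} : Matrix (Fin n) (Fin 2) k →ₗ[k] (Fin n → k) where
  toFun y i := y i 0
  map_add' _ _ := rfl
  map_smul' _ _ := rfl

/-- Values of `colOfTwo`. [folklore] -/
@[simp] theorem colOfTwo_apply {n : ℕ} (y : Matrix (Fin n) (Fin 2) k) (i : Fin n) :
    colOfTwo k y i = y i 0 := rfl

/-- `colOfTwo ∘ π_2 =` the first column. [folklore] -/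
theorem colOfTwo_comp_firstTwo {n : ℕ} (hn : 2 ≤ n) :
    (colOfTwo k).comp (firstTwo k hn) = colMap k (⟨0, by omega⟩ : Fin n) := by
  ext z i; rfl
set_option maxHeartbeats 400000 in -- buildfix (bf3-g26): 160k/180k FAIL, 200k PASS at accept time; line-neutral budget line
/-- **Bläser 2003, Theorem 14, case `rk a ≥ 2`, core** (pp. 57–58, after all coordinate changes):
a configuration with `S = {first q rows zero}` (`q = n − rk a ≤ n − 2`), a basis `J₁ ⊆ I` of the
first columns of `S'`, `n − 1 − |J₁|` indices `H₁ ∉ I` with first columns independent from them and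
in `Z_1`, and `S' ⊆ Z_1 ∩ {entry (1,2) = 0}` is contradictory: `W_1 = ⟨w_{J₁ ∪ H₁}⟩`, a projection
`p` onto `L_1` along it, `W_2 = ⟨p w_j | j ∈ J₂⟩` for `J₂ ⊆ I` completing `π_2(w_{J₁})` to a basis
of `π_2(S')` (`|J₂| ≥ 2`), a projection `p'` onto `L_2` along `W_2`, `n − 3` further indices of `I`
and Lemma 12 for the `p' p w_q`; then Lemma 5 sees `≥ 2n − 2` of the `w_ρ`.
[cite: Blaser2003, Theorem 14 (case rk a ≥ 2)] -/
theorem caseA_core (hn : 3 ≤ n) (hnm : n ≤ m) (hcard : Fintype.card ι = 2 * (m * n) + 2 * n - m - 3)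
    (β : BilinComp (mulBilin k n m n) ι) (I D J₁ H₁ : Finset ι) (q : ℕ) (hq2 : q + 2 ≤ n)
    (cfg : Config β (topZero k n n q) I D) (hJ₁I : J₁ ⊆ I) (hH₁I : Disjoint H₁ I)
    (hJH : J₁.card + H₁.card = n - 1)
    (hli : LinearIndepOn k (colMap k (⟨0, by omega⟩ : Fin n) ∘ β.w) ↑(J₁ ∪ H₁))
    (hJ₁span : ∀ i ∈ I, colMap k (⟨0, by omega⟩ : Fin n) (β.w i) ∈
      Submodule.span k ((colMap k (⟨0, by omega⟩ : Fin n) ∘ β.w) '' ↑J₁))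
    (hP5 : ∀ z ∈ Submodule.span k (β.w '' ↑I), z ⟨0, by omega⟩ ⟨0, by omega⟩ = 0)
    (hP6 : ∀ ρ ∈ H₁, β.w ρ ⟨0, by omega⟩ ⟨0, by omega⟩ = 0)
    (hP7 : ∀ z ∈ Submodule.span k (β.w '' ↑I), z ⟨0, by omega⟩ ⟨1, by omega⟩ = 0) :
    False := by
  classical
  have hn0 : 0 < n := by omega
  have hn2 : 2 ≤ n := by omega
  set j0 : Fin n := ⟨0, hn0⟩ with hj0
  set j1 : Fin n := ⟨1, by omega⟩ with hj1
  set S : Submodule k (Matrix (Fin n) (Fin n) k) := topZero k n n q with hS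
  set S' : Submodule k (Matrix (Fin n) (Fin n) k) := Submodule.span k (β.w '' ↑I) with hS'
  set c : ι → (Fin n → k) := colMap k j0 ∘ β.w with hc
  set π₂ := firstTwo k hn2 with hπ₂
  set d := D.card with hd
  set e := J₁.card with he
  have hdn : d ≤ n - 2 := cfg.card_D
  have hSle : S ≤ S' := by rw [hS', ← cfg.sup_eq]; exact le_sup_left
  have hfinS : (n - q) * n ≤ finrank k S := le_finrank_topZero (by omega)
  -- `J₂`: complete `π₂ w_{J₁}` to a basis of `π₂(S')` inside `I`
  have hliJ₁ : LinearIndepOn k (π₂ ∘ β.w) ↑J₁ := by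
    refine LinearIndepOn.of_comp (colOfTwo k) ?_
    have : ⇑(colOfTwo k) ∘ (π₂ ∘ β.w) = c := by
      funext ρ; rfl
    rw [this]
    exact hli.mono (by simp)
  obtain ⟨J₁₂, hJ₁₂I, hJ₁J₁₂, hJ₁₂span, hJ₁₂li⟩ :=
    exists_linearIndepOn_extension hliJ₁ (Finset.coe_subset.2 hJ₁I)
  set J₁₂f : Finset ι := (Set.toFinite J₁₂).toFinset with hJ₁₂f
  have hmem12 : ∀ i, i ∈ J₁₂f ↔ i ∈ J₁₂ := fun i => (Set.toFinite J₁₂).mem_toFinset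
  have hcoe12 : (J₁₂f : Set ι) = J₁₂ := by ext i; simp [hmem12]
  have hJ₁sub : J₁ ⊆ J₁₂f := fun i hi => (hmem12 i).2 (hJ₁J₁₂ (Finset.mem_coe.2 hi))
  have hJ₁₂subI : J₁₂f ⊆ I := fun i hi => Finset.mem_coe.1 (hJ₁₂I ((hmem12 i).1 hi))
  set J₂ := J₁₂f \ J₁ with hJ₂
  have hJ₂I : J₂ ⊆ I := fun i hi => hJ₁₂subI (Finset.mem_sdiff.1 hi).1
  have hJ₁J₂ : Disjoint J₁ J₂ := Finset.disjoint_sdiff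
  have hJunion : J₁ ∪ J₂ = J₁₂f := Finset.union_sdiff_of_subset hJ₁sub
  -- `|J₂| ≥ 2`
  have hJ₂card : 2 ≤ J₂.card := by
    -- `A = ⟨π₂ w_{J₁}⟩`, `B = ⟨π₂ E_{n-1,2}, π₂ E_{n-2,2}⟩` are independent inside `π₂(S')`
    set A : Submodule k (Matrix (Fin n) (Fin 2) k) := Submodule.span k ((π₂ ∘ β.w) '' ↑J₁) with hA
    have hAdim : finrank k A = e := finrank_span_image_eq_card _ J₁ hliJ₁
    set z₁ : Matrix (Fin n) (Fin n) k := Matrix.single ⟨n - 1, by omega⟩ j1 1 with hz₁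
    set z₂ : Matrix (Fin n) (Fin n) k := Matrix.single ⟨n - 2, by omega⟩ j1 1 with hz₂
    have hz₁S : z₁ ∈ S := fun i j hi => Matrix.single_apply_of_row_ne (by
      intro h; rw [← h] at hi; simp at hi; omega) _ _ _
    have hz₂S : z₂ ∈ S := fun i j hi => Matrix.single_apply_of_row_ne (by
      intro h; rw [← h] at hi; simp at hi; omega) _ _ _
    set bfam : Fin 2 → Matrix (Fin n) (Fin 2) k := ![π₂ z₁, π₂ z₂] with hbfam
    have hbli : LinearIndependent k bfam := by
      rw [Fintype.linearIndependent_iff]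
      intro g hg i
      have h1 := congrFun (congrFun hg ⟨n - 1, by omega⟩) 1
      have h2 := congrFun (congrFun hg ⟨n - 2, by omega⟩) 1
      simp only [hbfam, Fin.sum_univ_two, Matrix.add_apply, Matrix.smul_apply, smul_eq_mul,
        Matrix.cons_val_zero, Matrix.cons_val_one, Matrix.zero_apply, hπ₂, firstTwo_apply,
        hz₁, hz₂] at h1 h2
      have hne : (⟨n - 1, by omega⟩ : Fin n) ≠ ⟨n - 2, by omega⟩ := by
        intro h; have := congrArg Fin.val h; simp at this; omega
      have hj1' : (⟨((1 : Fin 2) : ℕ), by omega⟩ : Fin n) = j1 := Fin.ext (by simp [hj1])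
      rw [hj1'] at h1 h2
      rw [Matrix.single_apply_same, Matrix.single_apply_of_row_ne hne.symm, mul_one, mul_zero,
        add_zero] at h1
      rw [Matrix.single_apply_of_row_ne hne, Matrix.single_apply_same, mul_zero, mul_one,
        zero_add] at h2
      fin_cases i
      · exact h1
      · exact h2
    set B : Submodule k (Matrix (Fin n) (Fin 2) k) := Submodule.span k (Set.range bfam) with hB
    have hBdim : finrank k B = 2 := by rw [hB, finrank_span_eq_card hbli]; simp
    have hBcol : ∀ y ∈ B, colOfTwo k y = 0 := by
      intro y hy
      have : B ≤ LinearMap.ker (colOfTwo k) := by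
        rw [hB, Submodule.span_le]
        rintro _ ⟨i, rfl⟩
        rw [SetLike.mem_coe, LinearMap.mem_ker]
        funext i'
        fin_cases i <;> simp [hbfam, hπ₂, hz₁, hz₂, hj1]
      exact this hy
    have hAB : Disjoint A B := by
      rw [Submodule.disjoint_def]
      intro y hyA hyB
      have hker : Disjoint A (LinearMap.ker (colOfTwo k)) := by
        refine disjoint_span_image_ker (colOfTwo k) (π₂ ∘ β.w) ↑J₁ ?_
        have : ⇑(colOfTwo k) ∘ (π₂ ∘ β.w) = c := by funext ρ; rfl
        rw [this]; exact hli.mono (by simp)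
      exact Submodule.disjoint_def.1 hker y hyA (LinearMap.mem_ker.2 (hBcol y hyB))
    have hABle : A ⊔ B ≤ S'.map π₂ := by
      refine sup_le ?_ ?_
      · rw [hA, Submodule.span_le]
        rintro _ ⟨i, hi, rfl⟩
        exact ⟨β.w i, Submodule.subset_span ⟨i, hJ₁I hi, rfl⟩, rfl⟩
      · rw [hB, Submodule.span_le]
        rintro _ ⟨i, rfl⟩
        fin_cases i
        · exact ⟨z₁, hSle hz₁S, by simp [hbfam]⟩
        · exact ⟨z₂, hSle hz₂S, by simp [hbfam]⟩
    have hsum := Submodule.finrank_sup_add_finrank_inf_eq A B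
    rw [hAB.eq_bot, finrank_bot, add_zero, hAdim, hBdim] at hsum
    have h12dim : finrank k (S'.map π₂) = J₁₂f.card := by
      have h1 : S'.map π₂ = Submodule.span k ((π₂ ∘ β.w) '' ↑J₁₂f) := by
        rw [hS', map_span_image, hcoe12]
        exact le_antisymm (Submodule.span_le.2 hJ₁₂span) (Submodule.span_mono (Set.image_mono hJ₁₂I))
      rw [h1]; exact finrank_span_image_eq_card _ J₁₂f (by rw [hcoe12]; exact hJ₁₂li)
    have := Submodule.finrank_mono hABle
    rw [hsum, h12dim, ← hJunion, Finset.card_union_of_disjoint hJ₁J₂] at this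
    omega
  -- `|I \ J₁₂| ≥ n - 3`
  have hQex : n - 3 ≤ (I \ J₁₂f).card := by
    have h12dim : J₁₂f.card ≤ finrank k (S'.map π₂) := by
      have h1 : Submodule.span k ((π₂ ∘ β.w) '' ↑J₁₂f) ≤ S'.map π₂ := by
        rw [Submodule.span_le]
        rintro _ ⟨i, hi, rfl⟩
        exact ⟨β.w i, Submodule.subset_span ⟨i, hJ₁₂subI hi, rfl⟩, rfl⟩
      have := Submodule.finrank_mono h1
      rwa [finrank_span_image_eq_card _ J₁₂f (by rw [hcoe12]; exact hJ₁₂li)] at this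
    -- `dim π₂(S') ≤ dim π₂(S) + d ≤ 2 (n - q) + d`
    have hmapS : finrank k (S.map π₂) ≤ (n - q) * 2 := by
      have h1 : S.map π₂ ≤ topZero k n 2 q := by
        rintro _ ⟨z, hz, rfl⟩ i j hi
        simp [hπ₂, hz i _ hi]
      exact (Submodule.finrank_mono h1).trans (finrank_topZero_le (by omega))
    have hmapD : finrank k ((Submodule.span k (β.w '' ↑D)).map π₂) ≤ d :=
      (Submodule.finrank_map_le _ _).trans (finrank_span_image_le_card β.w D)
    have hmapS' : finrank k (S'.map π₂) ≤ (n - q) * 2 + d := by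
      rw [hS', ← cfg.sup_eq, Submodule.map_sup]
      exact (Submodule.finrank_add_le_finrank_add_finrank _ _).trans (add_le_add hmapS hmapD)
    rw [Finset.card_sdiff_of_subset hJ₁₂subI, cfg.card_I]
    obtain ⟨A, hA⟩ : ∃ A, n - q = A + 2 := ⟨n - q - 2, by omega⟩
    obtain ⟨N, hN⟩ : ∃ N, n = N + 2 := ⟨n - 2, by omega⟩
    have key : (n - q) * n = A * N + 2 * A + 2 * N + 4 := by rw [hA, hN]; ring
    rw [key] at hfinS
    rw [hA] at hmapS'
    omega
  -- `W₁` and the projection `p` onto `L_1` along it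
  set W₁ : Submodule k (Matrix (Fin n) (Fin n) k) := Submodule.span k (β.w '' ↑(J₁ ∪ H₁)) with hW₁
  have hW₁Z : ∀ z ∈ W₁, z j0 j0 = 0 := by
    intro z hz
    refine Submodule.span_induction (p := fun z _ => z j0 j0 = 0) ?_ rfl ?_ ?_ hz
    · rintro _ ⟨ρ, hρ, rfl⟩
      rcases Finset.mem_union.1 hρ with hρ | hρ
      · exact hP5 _ (Submodule.subset_span ⟨ρ, hJ₁I hρ, rfl⟩)
      · exact hP6 ρ hρ
    · intro y y' _ _ hy hy'; simp [Matrix.add_apply, hy, hy']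
    · intro a y _ hy; simp [hy]
  have hW₁disj : Disjoint W₁ (colZero k n n 1) := by
    refine (disjoint_span_image_ker (colMap k j0) β.w ↑(J₁ ∪ H₁) hli).mono_right fun z hz => ?_
    rw [LinearMap.mem_ker]; funext i; exact hz i j0 (by simp [hj0])
  obtain ⟨p, hpfix, hpkill, hprange⟩ := exists_proj_of_disjoint _ _ hW₁disj
  have hpkillJ₁ : ∀ z ∈ Submodule.span k (β.w '' ↑J₁), p z = 0 := fun z hz =>
    hpkill z (Submodule.span_mono (Set.image_mono (by simp)) hz)
  have hdecompI : ∀ i ∈ I, β.w i - p (β.w i) ∈ Submodule.span k (β.w '' ↑J₁) := by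
    intro i hi
    obtain ⟨cc, hcc, hcol⟩ := exists_mem_span_image_apply_eq (colMap k j0) β.w ↑J₁ (hJ₁span i hi)
    have hdiff : β.w i - cc ∈ colZero k n n 1 := by
      refine mem_colZero_succ hn0 (fun _ _ h => absurd h (Nat.not_lt_zero _)) ?_
      rw [map_sub, hcol, sub_self]
    have : p (β.w i) = β.w i - cc := by
      have h1 : p (β.w i - cc) = β.w i - cc := hpfix _ hdiff
      rw [map_sub, hpkillJ₁ cc hcc, sub_zero] at h1
      exact h1
    rw [this, sub_sub_cancel]; exact hcc
  have hpI : ∀ i ∈ I, p (β.w i) ∈ S' := by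
    intro i hi
    have h1 : β.w i - (β.w i - p (β.w i)) ∈ S' :=
      Submodule.sub_mem _ (Submodule.subset_span ⟨i, hi, rfl⟩)
        (Submodule.span_mono (Set.image_mono (Finset.coe_subset.2 hJ₁I)) (hdecompI i hi))
    simpa using h1
  -- `W₂` and the projection `p'` onto `L_2` along it
  set pw : ι → Matrix (Fin n) (Fin n) k := fun ρ => p (β.w ρ) with hpw
  set W₂ : Submodule k (Matrix (Fin n) (Fin n) k) := Submodule.span k (pw '' ↑J₂) with hW₂
  have hW₂L1 : W₂ ≤ colZero k n n 1 := Submodule.span_le.2 (by rintro _ ⟨ρ, _, rfl⟩; exact hprange _)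
  have hW₂S' : W₂ ≤ S' := Submodule.span_le.2 (by rintro _ ⟨ρ, hρ, rfl⟩; exact hpI ρ (hJ₂I hρ))
  -- independence of `π₂ (p w_j)`, `j ∈ J₂`
  have hsplit := (linearIndepOn_union_iff (Finset.disjoint_coe.2 hJ₁J₂)).1
    (by rw [← Finset.coe_union, hJunion, hcoe12]; exact hJ₁₂li)
  obtain ⟨-, hliJ₂, hdisjA⟩ := hsplit
  have hπpw : ∀ ρ ∈ J₂, π₂ (pw ρ) - π₂ (β.w ρ) ∈ Submodule.span k ((π₂ ∘ β.w) '' ↑J₁) := by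
    intro ρ hρ
    have h1 : π₂ (β.w ρ - pw ρ) ∈ (Submodule.span k (β.w '' ↑J₁)).map π₂ :=
      ⟨_, hdecompI ρ (hJ₂I hρ), rfl⟩
    rw [map_span_image] at h1
    have : π₂ (pw ρ) - π₂ (β.w ρ) = -(π₂ (β.w ρ - pw ρ)) := by rw [map_sub]; abel
    rw [this]; exact Submodule.neg_mem _ h1
  have hliW₂ : LinearIndepOn k (π₂ ∘ pw) ↑J₂ := by
    rw [linearIndepOn_iff]
    intro l hl hl0
    have hsupp : ↑l.support ⊆ (↑J₂ : Set ι) := (Finsupp.mem_supported _ l).1 hl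
    -- `Σ l_j π₂ w_j ∈ A₁ ∩ A₂ = 0`
    have h1 : Finsupp.linearCombination k (π₂ ∘ β.w) l ∈ Submodule.span k ((π₂ ∘ β.w) '' ↑J₂) :=
      (Finsupp.mem_span_image_iff_linearCombination k).2 ⟨l, hl, rfl⟩
    have h2 : Finsupp.linearCombination k (π₂ ∘ β.w) l ∈ Submodule.span k ((π₂ ∘ β.w) '' ↑J₁) := by
      have : Finsupp.linearCombination k (π₂ ∘ β.w) l =
          Finsupp.linearCombination k (π₂ ∘ pw) l -
            Finsupp.linearCombination k (fun ρ => π₂ (pw ρ) - π₂ (β.w ρ)) l := by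
        simp only [Finsupp.linearCombination_apply, Finsupp.sum]
        rw [← Finset.sum_sub_distrib]
        refine Finset.sum_congr rfl fun ρ _ => ?_
        simp only [Function.comp_apply, smul_sub]; abel
      rw [this, hl0, zero_sub]
      refine Submodule.neg_mem _ ?_
      simp only [Finsupp.linearCombination_apply, Finsupp.sum]
      exact Submodule.sum_mem _ fun ρ hρ => Submodule.smul_mem _ _ (hπpw ρ (hsupp hρ))
    have h0 : Finsupp.linearCombination k (π₂ ∘ β.w) l = 0 :=
      Submodule.disjoint_def.1 hdisjA _ h2 h1
    exact (linearIndepOn_iff.1 hliJ₂) l hl h0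
  have hW₂disj : Disjoint W₂ (colZero k n n 2) := by
    refine (disjoint_span_image_ker π₂ pw ↑J₂ hliW₂).mono_right fun z hz => ?_
    rw [LinearMap.mem_ker]; exact (firstTwo_eq_zero_iff hn2 z).2 hz
  obtain ⟨p', hp'fix, hp'kill, hp'range⟩ := exists_proj_of_disjoint _ _ hW₂disj
  -- for `z ∈ S' ∩ L_1`: `z - p' z ∈ W₂`
  have hdecomp2 : ∀ z ∈ S', z ∈ colZero k n n 1 → z - p' z ∈ W₂ := by
    intro z hz hzL
    have hπz : π₂ z ∈ Submodule.span k ((π₂ ∘ β.w) '' J₁₂) := by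
      have h1 : π₂ z ∈ S'.map π₂ := ⟨z, hz, rfl⟩
      rw [hS', map_span_image] at h1
      exact (Submodule.span_le.2 hJ₁₂span) h1
    have hle : Submodule.span k ((π₂ ∘ β.w) '' J₁₂) ≤
        Submodule.span k ((π₂ ∘ β.w) '' ↑J₁) ⊔ Submodule.span k ((π₂ ∘ pw) '' ↑J₂) := by
      rw [Submodule.span_le, ← hcoe12, ← hJunion, Finset.coe_union]
      rintro _ ⟨ρ, hρ, rfl⟩
      rcases hρ with hρ | hρ
      · exact Submodule.mem_sup_left (Submodule.subset_span ⟨ρ, hρ, rfl⟩)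
      · have : (π₂ ∘ β.w) ρ = -(π₂ (pw ρ) - π₂ (β.w ρ)) + (π₂ ∘ pw) ρ := by
          simp only [Function.comp_apply]; abel
        rw [this]
        exact Submodule.add_mem _ (Submodule.mem_sup_left (Submodule.neg_mem _ (hπpw ρ hρ)))
          (Submodule.mem_sup_right (Submodule.subset_span ⟨ρ, hρ, rfl⟩))
    obtain ⟨y₁, hy₁, y₂, hy₂, hsum⟩ := Submodule.mem_sup.1 (hle hπz)
    have hcoly₂ : colOfTwo k y₂ = 0 := by
      have : Submodule.span k ((π₂ ∘ pw) '' ↑J₂) ≤ LinearMap.ker (colOfTwo k) := by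
        rw [Submodule.span_le]
        rintro _ ⟨ρ, _, rfl⟩
        rw [SetLike.mem_coe, LinearMap.mem_ker]
        funext i
        exact hprange (β.w ρ) i j0 (by simp [hj0])
      exact this hy₂
    have hcolz : colOfTwo k (π₂ z) = 0 := funext fun i => hzL i j0 (by simp [hj0])
    have hy₁0 : y₁ = 0 := by
      have hker : Disjoint (Submodule.span k ((π₂ ∘ β.w) '' ↑J₁)) (LinearMap.ker (colOfTwo k)) := by
        refine disjoint_span_image_ker (colOfTwo k) (π₂ ∘ β.w) ↑J₁ ?_
        have : ⇑(colOfTwo k) ∘ (π₂ ∘ β.w) = c := by funext ρ; rfl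
        rw [this]; exact hli.mono (by simp)
      refine Submodule.disjoint_def.1 hker y₁ hy₁ (LinearMap.mem_ker.2 ?_)
      have := congrArg (colOfTwo k) hsum
      rwa [map_add, hcoly₂, add_zero, hcolz] at this
    rw [hy₁0, zero_add] at hsum
    obtain ⟨w₂, hw₂, hπw₂⟩ := exists_mem_span_image_apply_eq π₂ pw ↑J₂ (hsum ▸ hy₂)
    have hzw₂ : z - w₂ ∈ colZero k n n 2 := by
      rw [← firstTwo_eq_zero_iff hn2, ← hπ₂, map_sub, hπw₂, sub_self]
    have : p' z = z - w₂ := by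
      have h1 : p' (z - w₂) = z - w₂ := hp'fix _ hzw₂
      rw [map_sub, hp'kill w₂ hw₂, sub_zero] at h1
      exact h1
    rw [this, sub_sub_cancel]; exact hw₂
  -- `n - 3` further indices of `I` and Lemma 12
  obtain ⟨Q₁, hQ₁sub, hQ₁card⟩ := Finset.exists_subset_card_eq hQex
  let eQ := Q₁.equivFin
  let x : Fin Q₁.card → Matrix (Fin n) (Fin n) k := fun l => p' (pw (eQ.symm l))
  obtain ⟨v, v', hv, hv', hvfix, t, W12, ht1, hts, hW12, hW12t, hW12dim, hmem12⟩ :=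
    blaser2003_lemma12 Q₁.card 2 x (by rw [hQ₁card]; omega) (fun l => hp'range _)
  -- the final computation and flag
  set Φ := sandwichEquiv 1 1 v v' (Matrix.one_mul 1) (Matrix.one_mul 1) hv' hv with hΦ
  set βf := β.sandwich 1 1 v v' (Matrix.one_mul 1) hv' with hβf
  have hβfw : ∀ ρ, βf.w ρ = Φ (β.w ρ) := fun ρ => by simp [hβf, hΦ]
  have hΦap : ∀ z, Φ z = z * v := fun z => by rw [hΦ, sandwichEquiv_apply, Matrix.one_mul]
  set Wf : ℕ → Submodule k (Matrix (Fin n) (Fin n) k) := fun τ =>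
    if τ = 1 then W₁.map (Φ : Matrix (Fin n) (Fin n) k →ₗ[k] _)
    else if τ = 2 then W₂.map (Φ : Matrix (Fin n) (Fin n) k →ₗ[k] _) else W12 (τ - 2) with hWf
  have hWf1 : Wf 1 = W₁.map (Φ : Matrix (Fin n) (Fin n) k →ₗ[k] _) := by
    show (if (1 : ℕ) = 1 then _ else _) = _; rw [if_pos rfl]
  have hWf2 : Wf 2 = W₂.map (Φ : Matrix (Fin n) (Fin n) k →ₗ[k] _) := by
    show (if (2 : ℕ) = 1 then _ else if (2 : ℕ) = 2 then _ else _) = _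
    rw [if_neg (by omega), if_pos rfl]
  have hWfsucc : ∀ τ, 1 ≤ τ → Wf (τ + 2) = W12 τ := fun τ hτ => by
    show (if τ + 2 = 1 then _ else if τ + 2 = 2 then _ else W12 (τ + 2 - 2)) = _
    rw [if_neg (by omega), if_neg (by omega), Nat.add_sub_cancel]
  have hWf1Z : Wf 1 ≤ zSub k n n 1 := by
    rw [hWf1]
    rintro _ ⟨z, hz, rfl⟩
    refine ⟨fun i j hj => absurd hj (by omega), fun i j hi hj => ?_⟩
    have hi' : i = j0 := Fin.ext (by simp [hj0, hi])
    have hj' : j = j0 := Fin.ext (by simp [hj0]; omega)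
    subst hi' hj'
    rw [LinearEquiv.coe_coe, hΦap, mul_apply_of_fixesCols hvfix z j0 j0 (by simp [hj0])]
    exact hW₁Z z hz
  have hWf1L : Disjoint (Wf 1) (colZero k n n 1) := by
    rw [hWf1, Submodule.disjoint_def]
    rintro _ ⟨z, hz, rfl⟩ hzL
    have hzL' : z ∈ colZero k n n 1 := fun i j hj => by
      rw [← mul_apply_of_fixesCols hvfix z i j (by omega)]
      have := hzL i j hj; rwa [LinearEquiv.coe_coe, hΦap] at this
    have := Submodule.disjoint_def.1 hW₁disj z hz hzL'
    simp [this]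
  have hWf2Z : Wf 2 ≤ zSub k n n 2 := by
    rw [hWf2]
    rintro _ ⟨z, hz, rfl⟩
    refine ⟨fun i j hj => ?_, fun i j hi hj => ?_⟩
    · rw [LinearEquiv.coe_coe, hΦap, mul_apply_of_fixesCols hvfix z i j (by omega)]
      exact hW₂L1 hz i j (by omega)
    · have hi' : i = j0 := Fin.ext (by simp [hj0, hi])
      have hj' : j = j1 := Fin.ext (by simp [hj1]; omega)
      subst hi' hj'
      rw [LinearEquiv.coe_coe, hΦap, mul_apply_of_fixesCols hvfix z j0 j1 (by simp [hj1])]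
      exact hP7 z (hW₂S' hz)
  have hWf2L : Disjoint (Wf 2) (colZero k n n 2) := by
    rw [hWf2, Submodule.disjoint_def]
    rintro _ ⟨z, hz, rfl⟩ hzL
    have hzL' : z ∈ colZero k n n 2 := fun i j hj => by
      rw [← mul_apply_of_fixesCols hvfix z i j (by omega)]
      have := hzL i j hj; rwa [LinearEquiv.coe_coe, hΦap] at this
    have := Submodule.disjoint_def.1 hW₂disj z hz hzL'
    simp [this]
  -- membership facts
  have hmemW1 : ∀ z ∈ W₁, Φ z ∈ ⨆ τ ∈ Finset.Icc 1 (t + 2), Wf τ := fun z hz =>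
    mem_biSup_of_mem Wf (τ := 1) (Finset.mem_Icc.2 ⟨le_rfl, by omega⟩) (by rw [hWf1]; exact ⟨z, hz, rfl⟩)
  have hmemW2 : ∀ z ∈ W₂, Φ z ∈ ⨆ τ ∈ Finset.Icc 1 (t + 2), Wf τ := fun z hz =>
    mem_biSup_of_mem Wf (τ := 2) (Finset.mem_Icc.2 ⟨by omega, by omega⟩) (by rw [hWf2]; exact ⟨z, hz, rfl⟩)
  have hmem12' : ∀ l, Φ (x l) ∈ ⨆ τ ∈ Finset.Icc 1 (t + 2), Wf τ := by
    intro l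
    rw [hΦap]
    refine biSup_induction W12 (motive := fun y => y ∈ ⨆ τ ∈ Finset.Icc 1 (t + 2), Wf τ) (hmem12 l)
      (fun τ hτ y hy => ?_) (Submodule.zero_mem _) (fun y y' hy hy' => Submodule.add_mem _ hy hy')
    obtain ⟨hτ1, hτ2⟩ := Finset.mem_Icc.1 hτ
    exact mem_biSup_of_mem Wf (τ := τ + 2) (Finset.mem_Icc.2 ⟨by omega, by omega⟩)
      (by rw [hWfsucc τ hτ1]; exact hy)
  have hW₁J₁ : ∀ i ∈ I, β.w i - p (β.w i) ∈ W₁ := fun i hi =>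
    Submodule.span_mono (Set.image_mono (by simp)) (hdecompI i hi)
  set N := (J₁ ∪ H₁) ∪ J₂ ∪ Q₁ with hN
  have hNmem : ∀ ρ ∈ N, βf.w ρ ∈ ⨆ τ ∈ Finset.Icc 1 (t + 2), Wf τ := by
    intro ρ hρ
    rw [hβfw]
    rcases Finset.mem_union.1 hρ with hρ | hρ
    · rcases Finset.mem_union.1 hρ with hρ | hρ
      · exact hmemW1 _ (Submodule.subset_span ⟨ρ, hρ, rfl⟩)
      · have : Φ (β.w ρ) = Φ (β.w ρ - p (β.w ρ)) + Φ (pw ρ) := by rw [← map_add]; simp [hpw]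
        rw [this]
        exact Submodule.add_mem _ (hmemW1 _ (hW₁J₁ ρ (hJ₂I hρ)))
          (hmemW2 _ (Submodule.subset_span ⟨ρ, hρ, rfl⟩))
    · have hρI : ρ ∈ I := (Finset.mem_sdiff.1 (hQ₁sub hρ)).1
      have : Φ (β.w ρ) = Φ (β.w ρ - p (β.w ρ)) + Φ (pw ρ - p' (pw ρ)) + Φ (x (eQ ⟨ρ, hρ⟩)) := by
        rw [← map_add, ← map_add]; simp [hpw, x]
      rw [this]
      refine Submodule.add_mem _ (Submodule.add_mem _ (hmemW1 _ (hW₁J₁ ρ hρI)) (hmemW2 _ ?_))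
        (hmem12' _)
      exact hdecomp2 (pw ρ) (hpI ρ hρI) (hprange _)
  have hNcard : 2 * n - 2 ≤ N.card := by
    have h1 : Disjoint (J₁ ∪ H₁) J₂ := Finset.disjoint_left.2 fun i hi hiJ₂ => by
      rcases Finset.mem_union.1 hi with hi | hi
      · exact Finset.disjoint_left.1 hJ₁J₂ hi hiJ₂
      · exact Finset.disjoint_left.1 hH₁I hi (hJ₂I hiJ₂)
    have h2 : Disjoint (J₁ ∪ H₁ ∪ J₂) Q₁ := Finset.disjoint_left.2 fun i hi hiQ => by
      have hiI : i ∈ I := (Finset.mem_sdiff.1 (hQ₁sub hiQ)).1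
      have hi12 : i ∉ J₁₂f := (Finset.mem_sdiff.1 (hQ₁sub hiQ)).2
      rcases Finset.mem_union.1 hi with hi | hi
      · rcases Finset.mem_union.1 hi with hi | hi
        · exact hi12 (hJ₁sub hi)
        · exact Finset.disjoint_left.1 hH₁I hi hiI
      · exact hi12 (Finset.mem_sdiff.1 hi).1
    have hJH' : Disjoint J₁ H₁ := Finset.disjoint_left.2 fun i hi hiH =>
      Finset.disjoint_left.1 hH₁I hiH (hJ₁I hi)
    rw [hN, Finset.card_union_of_disjoint h2, Finset.card_union_of_disjoint h1,
      Finset.card_union_of_disjoint hJH', hQ₁card]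
    omega
  -- Lemma 5
  have hbound := blaser2003_lemma5_card βf hn0 (t := t + 2) (by omega) (by omega) Wf
    (fun τ h1 h2 => by
      rcases Nat.lt_or_ge 2 τ with hτ | hτ
      · obtain ⟨τ', rfl⟩ : ∃ τ', τ = τ' + 2 := ⟨τ - 2, by omega⟩
        rw [hWfsucc τ' (by omega), Nat.add_comm τ' 2]
        exact (hW12 τ' (by omega) (by omega)).1
      · rcases Nat.lt_or_ge 1 τ with hτ' | hτ'
        · have : τ = 2 := by omega
          subst this; exact hWf2Z
        · have : τ = 1 := by omega
          subst this; exact hWf1Z)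
    (fun τ h1 h2 => by
      rcases Nat.lt_or_ge 2 τ with hτ | hτ
      · obtain ⟨τ', rfl⟩ : ∃ τ', τ = τ' + 2 := ⟨τ - 2, by omega⟩
        rw [hWfsucc τ' (by omega), Nat.add_comm τ' 2]
        exact (hW12 τ' (by omega) (by omega)).2
      · rcases Nat.lt_or_ge 1 τ with hτ' | hτ'
        · have : τ = 2 := by omega
          subst this; exact hWf2L
        · have : τ = 1 := by omega
          subst this; exact hWf1L)
    (by rw [hWfsucc t ht1, Nat.add_comm t 2]; exact hW12t)
    (by rw [hWfsucc t ht1]; exact hW12dim) N hNmem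
  rw [hcard, Nat.mul_comm n m, Nat.mul_sub_one] at hbound
  have : m ≤ m * n := by nlinarith
  have : 3 * m ≤ m * n := by nlinarith
  omega

omit [Fintype ι] [DecidableEq ι] in
/-- The span of the transported vectors is the image of the span. [folklore] -/
theorem span_image_eq_map_of_eq {W : Type*} [AddCommGroup W] [Module k W] {w w₂ : ι → W}
    (Φ : W ≃ₗ[k] W) (h : ∀ i, w₂ i = Φ (w i)) (X : Set ι) :
    Submodule.span k (w₂ '' X) = (Submodule.span k (w '' X)).map (Φ : W →ₗ[k] W) := by
  have hw : w₂ = Φ ∘ w := funext h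
  rw [hw, map_span_image]; rfl

/-- **Bläser 2003, Theorem 14, case `rk a ≥ 2`** (pp. 56–57): a configuration with
`S = {first q rows zero}`, `1 ≤ q ≤ n − 2`, is contradictory. The preparatory moves of the printed
proof: column operations making the `(1,1)` entries of the `w_i`, `i ∈ D`, zero (so `S' ⊆ Z_1`);
row operations on the first `q` rows adapted to the first columns of `S'` ((5): they become
exactly the vectors with vanishing first `n'` coordinates); a basis `J₁ ⊆ I` of these first
columns and `n − 1 − |J₁|` further indices `H₁ ∉ I`; row operations on the first `n'` rows making
the `(1,1)` entries of the `w_h`, `h ∈ H₁`, zero; column operations on the columns `≥ 2` making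
the `(1,2)` entries on `S'` zero ((6)). Then `caseA_core`.
[cite: Blaser2003, Theorem 14 (case rk a ≥ 2)] -/
theorem caseA_false (hn : 3 ≤ n) (hnm : n ≤ m) (hcard : Fintype.card ι = 2 * (m * n) + 2 * n - m - 3)
    (β : BilinComp (mulBilin k n m n) ι) (I D : Finset ι) (q : ℕ) (hq1 : 1 ≤ q) (hq2 : q + 2 ≤ n)
    (cfg : Config β (topZero k n n q) I D) : False := by
  classical
  have hn0 : 0 < n := by omega
  set j0 : Fin n := ⟨0, hn0⟩ with hj0
  set j1 : Fin n := ⟨1, by omega⟩ with hj1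
  set S : Submodule k (Matrix (Fin n) (Fin n) k) := topZero k n n q with hS
  have hdn : D.card ≤ n - 2 := cfg.card_D
  have hSrow : ∀ z ∈ S, ∀ j, z j0 j = 0 := fun z hz j => hz j0 j (by simp [hj0]; omega)
  -- A1: column operations making the `(1,1)` entries of the `w_i`, `i ∈ D`, zero
  let T₁ : (Fin n → k) →ₗ[k] (D → k) :=
    { toFun := fun cv i => ∑ l, β.w i j0 l * cv l
      map_add' := fun c c' => by funext i; simp [mul_add, Finset.sum_add_distrib]
      map_smul' := fun a c => by funext i; simp [Finset.mul_sum, mul_left_comm] }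
  have hker₁ : LinearMap.ker T₁ ≠ ⊥ := LinearMap.ker_ne_bot_of_finrank_lt (by
    simp only [finrank_fintype_fun_eq_card, Fintype.card_coe, Fintype.card_fin]; omega)
  obtain ⟨cv, hcvT, hcv0⟩ := Submodule.exists_mem_ne_zero_of_ne_bot hker₁
  obtain ⟨L₁, hL₁⟩ := exists_linearEquiv_apply_single_eq hn0 cv hcv0
  set v₁ := LinearMap.toMatrix' L₁.toLinearMap with hv₁_def
  set v₁' := LinearMap.toMatrix' L₁.symm.toLinearMap with hv₁'_def
  have hv₁ : v₁ * v₁' = 1 := toMatrix'_mul_toMatrix'_symm L₁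
  have hv₁' : v₁' * v₁ = 1 := toMatrix'_symm_mul_toMatrix' L₁
  have hv₁col : ∀ l, v₁ l j0 = cv l := fun l => by
    rw [hv₁_def, LinearMap.toMatrix'_apply]; simp only [LinearEquiv.coe_coe]; rw [hj0, hL₁]
  set β₁ := β.sandwich 1 1 v₁ v₁' (Matrix.one_mul 1) hv₁' with hβ₁
  have hw₁ : ∀ ρ, β₁.w ρ = β.w ρ * v₁ := fun ρ => by simp [hβ₁]
  have cfg₁ : Config β₁ S I D := by
    have h := cfg.sandwich 1 1 v₁ v₁' (Matrix.one_mul 1) (Matrix.one_mul 1) hv₁' hv₁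
    rwa [hS, map_sandwichEquiv_topZero 1 1 v₁ v₁' _ _ hv₁' hv₁ (isTopBlock_one q)] at h
  have hP1 : ∀ i ∈ D, β₁.w i j0 j0 = 0 := by
    intro i hi
    rw [hw₁, Matrix.mul_apply]
    simp_rw [hv₁col]
    have := congrFun (LinearMap.mem_ker.1 hcvT) ⟨i, hi⟩
    simpa [T₁] using this
  have hP1' : ∀ z ∈ Submodule.span k (β₁.w '' ↑I), z j0 j0 = 0 := by
    intro z hz
    rw [← cfg₁.sup_eq] at hz
    obtain ⟨sS, hsS, wD, hwD, rfl⟩ := Submodule.mem_sup.1 hz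
    rw [Matrix.add_apply, hSrow sS hsS, zero_add]
    refine Submodule.span_induction (p := fun z _ => z j0 j0 = 0) ?_ rfl ?_ ?_ hwD
    · rintro _ ⟨i, hi, rfl⟩; exact hP1 i hi
    · intro y y' _ _ hy hy'; simp [Matrix.add_apply, hy, hy']
    · intro a y _ hy; simp [hy]
  clear cfg
  -- A3: row operations on the first `q` rows adapted to the first columns of `S'` ((5))
  have hq0 : 0 + q ≤ n := by omega
  let topW : (Fin n → k) →ₗ[k] (Fin q → k) :=
    { toFun := window 0 q hq0, map_add' := fun _ _ => rfl, map_smul' := fun _ _ => rfl }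
  set F₁ : Submodule k (Fin n → k) := (Submodule.span k (β₁.w '' ↑I)).map (colMap k j0) with hF₁
  set F₁' : Submodule k (Fin q → k) := F₁.map topW with hF₁'
  have hδ : finrank k F₁' + 1 ≤ q := by
    set K₀ : Submodule k (Fin q → k) := LinearMap.ker (LinearMap.proj (⟨0, hq1⟩ : Fin q)) with hK₀
    have hle : F₁' ≤ K₀ := by
      rintro _ ⟨cc, ⟨z, hz, rfl⟩, rfl⟩
      rw [hK₀, LinearMap.mem_ker, LinearMap.proj_apply]
      show (colMap k j0 z) (blkEmb 0 q hq0 ⟨0, hq1⟩) = 0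
      have : blkEmb 0 q hq0 ⟨0, hq1⟩ = j0 := Fin.ext (by simp [hj0])
      rw [colMap_apply, this]; exact hP1' z hz
    have hK₀top : K₀ ≠ ⊤ := by
      intro htop
      have : (Pi.single ⟨0, hq1⟩ 1 : Fin q → k) ∈ K₀ := htop ▸ Submodule.mem_top
      rw [hK₀, LinearMap.mem_ker, LinearMap.proj_apply] at this
      simp at this
    have h1 := Submodule.finrank_lt hK₀top
    have h2 := Submodule.finrank_mono hle
    rw [finrank_fintype_fun_eq_card, Fintype.card_fin] at h1
    omega
  obtain ⟨A, hA⟩ := exists_linearEquiv_adapted F₁' (α := finrank k F₁') rfl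
  set n' := q - finrank k F₁' with hn'_def
  have hn'1 : 1 ≤ n' := by omega
  have hn'q : n' ≤ q := Nat.sub_le _ _
  set A₅ := LinearMap.toMatrix' A.toLinearMap with hA₅
  set A₅' := LinearMap.toMatrix' A.symm.toLinearMap with hA₅'
  set u₅ := blockEmbed n 0 q A₅ with hu₅_def
  set u₅' := blockEmbed n 0 q A₅' with hu₅'_def
  have hu₅ : u₅ * u₅' = 1 := blockEmbed_mul_blockEmbed_eq_one 0 q hq0 A₅ A₅' (toMatrix'_mul_toMatrix'_symm A)
  have hu₅' : u₅' * u₅ = 1 := blockEmbed_mul_blockEmbed_eq_one 0 q hq0 A₅' A₅ (toMatrix'_symm_mul_toMatrix' A)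
  have hu₅top : IsTopBlock q u₅ := isTopBlock_blockEmbed q A₅
  set β₅ := β₁.sandwich u₅ u₅' 1 1 hu₅ (Matrix.one_mul 1) with hβ₅
  have hw₅ : ∀ ρ, β₅.w ρ = u₅ * β₁.w ρ := fun ρ => by simp [hβ₅]
  have cfg₅ : Config β₅ S I D := by
    have h := cfg₁.sandwich u₅ u₅' 1 1 hu₅ hu₅' (Matrix.one_mul 1) (Matrix.one_mul 1)
    rwa [hS, map_sandwichEquiv_topZero u₅ u₅' 1 1 hu₅ hu₅' _ _ hu₅top] at h
  -- the first columns after (5): exactly the vectors with vanishing first `n'` coordinates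
  set F₅ : Submodule k (Fin n → k) := (Submodule.span k (β₅.w '' ↑I)).map (colMap k j0) with hF₅
  have hspan₅ : Submodule.span k (β₅.w '' ↑I) =
      (Submodule.span k (β₁.w '' ↑I)).map (mulLeftLin k u₅) := by
    have : β₅.w = mulLeftLin k u₅ ∘ β₁.w := funext fun ρ => by rw [Function.comp_apply, mulLeftLin_apply, hw₅]
    rw [this, map_span_image]
  have hF₅F₁ : ∀ cc, cc ∈ F₅ ↔ ∃ cc₁ ∈ F₁, u₅ *ᵥ cc₁ = cc := by
    intro cc
    rw [hF₅, hspan₅]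
    constructor
    · rintro ⟨_, ⟨z, hz, rfl⟩, rfl⟩
      exact ⟨colMap k j0 z, ⟨z, hz, rfl⟩, by rw [mulLeftLin_apply, colMap_mul]⟩
    · rintro ⟨_, ⟨z, hz, rfl⟩, rfl⟩
      exact ⟨u₅ * z, ⟨z, hz, rfl⟩, by rw [colMap_mul]⟩
  have hu₅blk : ∀ (cc : Fin n → k) (i : Fin q), (u₅ *ᵥ cc) (blkEmb 0 q hq0 i) = A (topW cc) i := by
    intro cc i
    rw [hu₅_def, blockEmbed_mulVec_blk 0 q hq0 A₅ cc i, hA₅, LinearMap.toMatrix'_mulVec]; rfl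
  have hu₅'blkEmb : ∀ (cc : Fin n → k) (i : Fin q), (u₅' *ᵥ cc) (blkEmb 0 q hq0 i) = A.symm (topW cc) i := by
    intro cc i
    rw [hu₅'_def, blockEmbed_mulVec_blk 0 q hq0 A₅' cc i, hA₅', LinearMap.toMatrix'_mulVec]; rfl
  -- (⇒)
  have hF₅zero : ∀ cc ∈ F₅, ∀ i : Fin n, (i : ℕ) < n' → cc i = 0 := by
    intro cc hcc i hi
    obtain ⟨cc₁, hcc₁, rfl⟩ := (hF₅F₁ cc).1 hcc
    have hi' : i = blkEmb 0 q hq0 ⟨i, by omega⟩ := Fin.ext (by simp)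
    rw [hi', hu₅blk]
    exact (hA _).1 ⟨cc₁, hcc₁, rfl⟩ ⟨i, by omega⟩ (by simp only; omega)
  -- (⇐)
  have hKq : ∀ g : Fin n → k, (∀ i : Fin n, (i : ℕ) < q → g i = 0) → g ∈ F₁ := by
    intro g hg
    refine ⟨Matrix.of fun i j => if j = j0 then g i else 0, ?_, funext fun i => by simp⟩
    have : (Matrix.of fun i j => if j = j0 then g i else 0) ∈ S := fun i j hi => by simp [hg i hi]
    rw [← cfg₁.sup_eq]; exact Submodule.mem_sup_left this
  have hF₅of : ∀ cc : Fin n → k, (∀ i : Fin n, (i : ℕ) < n' → cc i = 0) → cc ∈ F₅ := by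
    intro cc hcc
    set cc₁ := u₅' *ᵥ cc with hcc₁
    have htop : topW cc₁ ∈ F₁' := by
      rw [hA]
      intro i hi
      have : topW cc₁ = A.symm (topW cc) := funext fun i' => by
        show cc₁ (blkEmb 0 q hq0 i') = _; rw [hcc₁, hu₅'blkEmb]
      rw [this, LinearEquiv.apply_symm_apply]
      exact hcc (blkEmb 0 q hq0 i) (by simp only [blkEmb_val]; omega)
    obtain ⟨f, hf, hff⟩ := htop
    have hdiff : cc₁ - f ∈ F₁ := hKq _ fun i hi => by
      have := congrFun hff ⟨i, hi⟩
      have hi' : blkEmb 0 q hq0 ⟨i, hi⟩ = i := Fin.ext (by simp)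
      simp only [Pi.sub_apply]
      rw [← hi']
      exact sub_eq_zero.2 this.symm
    have hcc₁F : cc₁ ∈ F₁ := by simpa using Submodule.add_mem _ hdiff hf
    refine (hF₅F₁ cc).2 ⟨cc₁, hcc₁F, ?_⟩
    rw [hcc₁, Matrix.mulVec_mulVec, hu₅, Matrix.one_mulVec]
  -- `J₁`, `e`
  set c₅ : ι → (Fin n → k) := colMap k j0 ∘ β₅.w with hc₅
  have hF₅span : F₅ = Submodule.span k (c₅ '' ↑I) := by rw [hF₅, hc₅, map_span_image]
  obtain ⟨J₁₀, hJ₁₀I, -, hJ₁₀span, hJ₁₀li⟩ :=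
    exists_linearIndepOn_extension (linearIndepOn_empty k c₅) (Set.empty_subset (I : Set ι))
  set J₁ : Finset ι := (Set.toFinite J₁₀).toFinset with hJ₁
  have hmemJ₁ : ∀ i, i ∈ J₁ ↔ i ∈ J₁₀ := fun i => (Set.toFinite J₁₀).mem_toFinset
  have hcoeJ₁ : (J₁ : Set ι) = J₁₀ := by ext i; simp [hmemJ₁]
  have hJ₁I : J₁ ⊆ I := fun i hi => Finset.mem_coe.1 (hJ₁₀I ((hmemJ₁ i).1 hi))
  have hJ₁span : ∀ i ∈ I, c₅ i ∈ Submodule.span k (c₅ '' ↑J₁) := fun i hi => by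
    rw [hcoeJ₁]; exact hJ₁₀span ⟨i, hi, rfl⟩
  have hF₅J₁ : F₅ = Submodule.span k (c₅ '' ↑J₁) := by
    rw [hF₅span]
    exact le_antisymm (Submodule.span_le.2 (by rintro _ ⟨i, hi, rfl⟩; exact hJ₁span i hi))
      (Submodule.span_mono (Set.image_mono (Finset.coe_subset.2 hJ₁I)))
  set e := J₁.card with he
  have hedim : finrank k F₅ = e := by
    rw [hF₅J₁]; exact finrank_span_image_eq_card c₅ J₁ (by rw [hcoeJ₁]; exact hJ₁₀li)
  have hen : e + 1 ≤ n := by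
    set K : Submodule k (Fin n → k) := LinearMap.ker (LinearMap.proj j0) with hK
    have hle : F₅ ≤ K := fun cc hcc => by
      rw [hK, LinearMap.mem_ker, LinearMap.proj_apply]; exact hF₅zero cc hcc j0 (by simp [hj0]; omega)
    have hKtop : K ≠ ⊤ := by
      intro htop
      have : (Pi.single j0 1 : Fin n → k) ∈ K := htop ▸ Submodule.mem_top
      rw [hK, LinearMap.mem_ker, LinearMap.proj_apply] at this
      simp at this
    have h1 := Submodule.finrank_lt hKtop
    have h2 := Submodule.finrank_mono hle
    rw [finrank_fintype_fun_eq_card, Fintype.card_fin] at h1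
    omega
  have hne : n ≤ e + n' := by
    -- the `n - n'` unit vectors `e_i`, `i ≥ n'`, lie in `F₅`
    have hn'n : n' + (n - n') ≤ n := by omega
    have hmem : ∀ i : Fin (n - n'), (Pi.single (blkEmb n' (n - n') hn'n i) (1 : k) : Fin n → k) ∈ F₅ :=
      fun i => hF₅of _ fun i' hi' => by
        rw [Pi.single_apply, if_neg]
        intro h; rw [h] at hi'; simp only [blkEmb_val] at hi'; omega
    have hli0 : LinearIndependent k (fun i : Fin (n - n') =>
        (Pi.single (blkEmb n' (n - n') hn'n i) (1 : k) : Fin n → k)) := by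
      have h := (Pi.basisFun k (Fin n)).linearIndependent.comp (blkEmb n' (n - n') hn'n)
        (blkEmb n' (n - n') hn'n).injective
      have hfun : (fun i : Fin (n - n') => (Pi.single (blkEmb n' (n - n') hn'n i) (1 : k) : Fin n → k)) =
          ⇑(Pi.basisFun k (Fin n)) ∘ ⇑(blkEmb n' (n - n') hn'n) := by
        funext i; simp
      rw [hfun]; exact h
    have hli : LinearIndependent k (fun i : Fin (n - n') =>
        (⟨_, hmem i⟩ : F₅)) := LinearIndependent.of_comp F₅.subtype hli0
    have := hli.fintype_card_le_finrank
    rw [Fintype.card_fin, hedim] at this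
    omega
  -- `H₁`: complete the first columns of `J₁` by `n - 1 - e` first columns of indices outside `I`
  obtain ⟨B, -, hJ₁₀B, hBspan, hBli⟩ := exists_linearIndepOn_extension hJ₁₀li (Set.subset_univ J₁₀)
  set Bf : Finset ι := (Set.toFinite B).toFinset with hBf
  have hmemB : ∀ i, i ∈ Bf ↔ i ∈ B := fun i => (Set.toFinite B).mem_toFinset
  have hcoeB : (Bf : Set ι) = B := by ext i; simp [hmemB]
  have hc₅span : Submodule.span k (Set.range c₅) = ⊤ := by
    rw [hc₅, Set.range_comp, Submodule.span_image, cfg₅.span_top, Submodule.map_top,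
      LinearMap.range_eq_top]
    exact colMap_surjective j0
  have hBcard : Bf.card = n := by
    have h1 : finrank k (Submodule.span k (c₅ '' ↑Bf)) = Bf.card :=
      finrank_span_image_eq_card c₅ Bf (by rw [hcoeB]; exact hBli)
    have h2 : Submodule.span k (c₅ '' ↑Bf) = ⊤ := by
      apply le_antisymm le_top
      rw [← hc₅span, Submodule.span_le]
      rintro _ ⟨i, rfl⟩
      rw [hcoeB]
      exact hBspan ⟨i, Set.mem_univ _, rfl⟩
    rw [h2, finrank_top, finrank_fintype_fun_eq_card, Fintype.card_fin] at h1
    exact h1.symm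
  have hBIcard : (Bf ∩ I).card ≤ e := by
    have h1 : finrank k (Submodule.span k (c₅ '' ↑(Bf ∩ I))) = (Bf ∩ I).card :=
      finrank_span_image_eq_card c₅ (Bf ∩ I)
        (hBli.mono (by rw [← hcoeB]; exact Finset.coe_subset.2 Finset.inter_subset_left))
    have h2 : Submodule.span k (c₅ '' ↑(Bf ∩ I)) ≤ F₅ := by
      rw [hF₅span]
      exact Submodule.span_mono (Set.image_mono (Finset.coe_subset.2 Finset.inter_subset_right))
    have h3 := Submodule.finrank_mono h2
    omega
  have hH₁ex : n - 1 - e ≤ (Bf \ I).card := by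
    have := Finset.card_sdiff_add_card_inter Bf I
    omega
  obtain ⟨H₁, hH₁sub, hH₁card⟩ := Finset.exists_subset_card_eq hH₁ex
  have hH₁I : Disjoint H₁ I := Finset.disjoint_left.2 fun i hi => (Finset.mem_sdiff.1 (hH₁sub hi)).2
  have hJH : J₁.card + H₁.card = n - 1 := by rw [hH₁card]; omega
  have hJ₁H₁B : (↑(J₁ ∪ H₁) : Set ι) ⊆ B := by
    rw [Finset.coe_union]
    refine Set.union_subset (by rw [hcoeJ₁]; exact hJ₁₀B) fun i hi => ?_
    exact (hmemB i).1 (Finset.mem_sdiff.1 (hH₁sub hi)).1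
  have hli₅ : LinearIndepOn k c₅ ↑(J₁ ∪ H₁) := hBli.mono hJ₁H₁B
  have hJ₁H₁disj : Disjoint J₁ H₁ := Finset.disjoint_left.2 fun i hi hiH =>
    Finset.disjoint_left.1 hH₁I hiH (hJ₁I hi)
  -- row operations on the first `n'` rows making the `(1,1)` entries of the `w_h`, `h ∈ H₁`, zero
  have hn'0 : 0 + n' ≤ n := by omega
  let topW' : (Fin n → k) →ₗ[k] (Fin n' → k) :=
    { toFun := window 0 n' hn'0, map_add' := fun _ _ => rfl, map_smul' := fun _ _ => rfl }
  set D₆ : Submodule k (Fin n' → k) := Submodule.span k ((topW' ∘ c₅) '' ↑H₁) with hD₆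
  have hliH : LinearIndepOn k (topW' ∘ c₅) ↑H₁ := by
    rw [linearIndepOn_iff]
    intro l hl hl0
    have hcc : Finsupp.linearCombination k c₅ l ∈ F₅ := by
      refine hF₅of _ fun i hi => ?_
      have h1 : topW' (Finsupp.linearCombination k c₅ l) = 0 := by
        rw [Finsupp.apply_linearCombination]; exact hl0
      have hi' : i = blkEmb 0 n' hn'0 ⟨i, hi⟩ := Fin.ext (by simp)
      have := congrFun h1 ⟨i, hi⟩
      rw [hi']; exact this
    have hccH : Finsupp.linearCombination k c₅ l ∈ Submodule.span k (c₅ '' ↑H₁) :=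
      (Finsupp.mem_span_image_iff_linearCombination k).2 ⟨l, hl, rfl⟩
    obtain ⟨-, hliH₁, hdisjJH⟩ := (linearIndepOn_union_iff (Finset.disjoint_coe.2 hJ₁H₁disj)).1
      (by rw [← Finset.coe_union]; exact hli₅)
    rw [hF₅J₁] at hcc
    have h0 : Finsupp.linearCombination k c₅ l = 0 := Submodule.disjoint_def.1 hdisjJH _ hcc hccH
    exact (linearIndepOn_iff.1 hliH₁) l hl h0
  have hD₆dim : finrank k D₆ = n - 1 - e := by
    rw [hD₆, finrank_span_image_eq_card _ H₁ hliH, hH₁card]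
  obtain ⟨A₆L, hA₆L⟩ := exists_linearEquiv_adapted D₆ hD₆dim
  set A₆ := LinearMap.toMatrix' A₆L.toLinearMap with hA₆
  set A₆' := LinearMap.toMatrix' A₆L.symm.toLinearMap with hA₆'
  set u₆ := blockEmbed n 0 n' A₆ with hu₆_def
  set u₆' := blockEmbed n 0 n' A₆' with hu₆'_def
  have hu₆ : u₆ * u₆' = 1 := blockEmbed_mul_blockEmbed_eq_one 0 n' hn'0 A₆ A₆' (toMatrix'_mul_toMatrix'_symm A₆L)
  have hu₆' : u₆' * u₆ = 1 := blockEmbed_mul_blockEmbed_eq_one 0 n' hn'0 A₆' A₆ (toMatrix'_symm_mul_toMatrix' A₆L)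
  have hu₆top : IsTopBlock n' u₆ := isTopBlock_blockEmbed n' A₆
  set β₆ := β₅.sandwich u₆ u₆' 1 1 hu₆ (Matrix.one_mul 1) with hβ₆
  have hw₆ : ∀ ρ, β₆.w ρ = u₆ * β₅.w ρ := fun ρ => by simp [hβ₆]
  have cfg₆ : Config β₆ S I D := by
    have h := cfg₅.sandwich u₆ u₆' 1 1 hu₆ hu₆' (Matrix.one_mul 1) (Matrix.one_mul 1)
    rwa [hS, map_sandwichEquiv_topZero u₆ u₆' 1 1 hu₆ hu₆' _ _ (hu₆top.mono hn'q)] at h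
  set c₆ : ι → (Fin n → k) := colMap k j0 ∘ β₆.w with hc₆
  have hc₆c₅ : c₆ = u₆.mulVecLin ∘ c₅ := funext fun ρ => by
    simp only [hc₆, hc₅, Function.comp_apply, Matrix.mulVecLin_apply, hw₆, colMap_mul]
  have hli₆ : LinearIndepOn k c₆ ↑(J₁ ∪ H₁) := by
    rw [hc₆c₅]; exact hli₅.map_injOn _ (mulVec_injective_of_mul_eq_one hu₆').injOn
  have hJ₁span₆ : ∀ i ∈ I, c₆ i ∈ Submodule.span k (c₆ '' ↑J₁) := by
    intro i hi
    rw [hc₆c₅, ← map_span_image]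
    exact ⟨c₅ i, hJ₁span i hi, rfl⟩
  have hP6 : ∀ ρ ∈ H₁, β₆.w ρ j0 j0 = 0 := by
    intro ρ hρ
    have h1 : β₆.w ρ j0 j0 = (u₆ *ᵥ c₅ ρ) j0 := by
      rw [hw₆, ← colMap_apply j0 (u₆ * β₅.w ρ) j0, colMap_mul]; rfl
    have hj0' : j0 = blkEmb 0 n' hn'0 ⟨0, hn'1⟩ := Fin.ext (by simp [hj0])
    rw [h1, hj0', hu₆_def, blockEmbed_mulVec_blk 0 n' hn'0 A₆ (c₅ ρ) ⟨0, hn'1⟩, hA₆,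
      LinearMap.toMatrix'_mulVec]
    exact (hA₆L _).1 (Submodule.subset_span ⟨ρ, hρ, rfl⟩) ⟨0, hn'1⟩ (by simp only; omega)
  have hspan₆ : ∀ z ∈ Submodule.span k (β₆.w '' ↑I), ∃ z₅ ∈ Submodule.span k (β₅.w '' ↑I), z = u₆ * z₅ := by
    intro z hz
    have : β₆.w = mulLeftLin k u₆ ∘ β₅.w := funext fun ρ => by rw [Function.comp_apply, mulLeftLin_apply, hw₆]
    rw [this, ← map_span_image] at hz
    obtain ⟨z₅, hz₅, rfl⟩ := hz
    exact ⟨z₅, hz₅, rfl⟩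
  have hP5₆ : ∀ z ∈ Submodule.span k (β₆.w '' ↑I), z j0 j0 = 0 := by
    intro z hz
    obtain ⟨z₅, hz₅, rfl⟩ := hspan₆ z hz
    refine topBlock_mul_apply_eq_zero hu₆top z₅ j0 j0 (by simp [hj0]; omega) fun l hl => ?_
    have := hF₅zero (colMap k j0 z₅) ⟨z₅, hz₅, rfl⟩ l hl
    simpa using this
  -- A5: column operations on the columns `≥ 2` making the `(1,2)` entries on `S'` zero ((6))
  have h1n : 1 + (n - 1) ≤ n := by omega
  let T₇ : (Fin (n - 1) → k) →ₗ[k] (D → k) :=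
    { toFun := fun cv i => ∑ l : Fin (n - 1), β₆.w i j0 (blkEmb 1 (n - 1) h1n l) * cv l
      map_add' := fun c c' => by funext i; simp [mul_add, Finset.sum_add_distrib]
      map_smul' := fun a c => by funext i; simp [Finset.mul_sum, mul_left_comm] }
  have hker₇ : LinearMap.ker T₇ ≠ ⊥ := LinearMap.ker_ne_bot_of_finrank_lt (by
    simp only [finrank_fintype_fun_eq_card, Fintype.card_coe, Fintype.card_fin]; omega)
  obtain ⟨cv', hcv'T, hcv'0⟩ := Submodule.exists_mem_ne_zero_of_ne_bot hker₇
  obtain ⟨L₇, hL₇⟩ := exists_linearEquiv_apply_single_eq (by omega) cv' hcv'0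
  set A₇ := LinearMap.toMatrix' L₇.toLinearMap with hA₇
  set A₇' := LinearMap.toMatrix' L₇.symm.toLinearMap with hA₇'
  set v₇ := blockEmbed n 1 (n - 1) A₇ with hv₇_def
  set v₇' := blockEmbed n 1 (n - 1) A₇' with hv₇'_def
  have hv₇ : v₇ * v₇' = 1 := blockEmbed_mul_blockEmbed_eq_one 1 (n - 1) h1n A₇ A₇' (toMatrix'_mul_toMatrix'_symm L₇)
  have hv₇' : v₇' * v₇ = 1 := blockEmbed_mul_blockEmbed_eq_one 1 (n - 1) h1n A₇' A₇ (toMatrix'_symm_mul_toMatrix' L₇)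
  have hv₇fix : FixesCols 1 v₇ := fixesCols_blockEmbed 1 (n - 1) A₇
  have hA₇col : ∀ l : Fin (n - 1), A₇ l ⟨0, by omega⟩ = cv' l := fun l => by
    rw [hA₇, LinearMap.toMatrix'_apply]; simp only [LinearEquiv.coe_coe]; rw [hL₇]
  set β₇ := β₆.sandwich 1 1 v₇ v₇' (Matrix.one_mul 1) hv₇' with hβ₇
  have hw₇ : ∀ ρ, β₇.w ρ = β₆.w ρ * v₇ := fun ρ => by simp [hβ₇]
  have cfg₇ : Config β₇ S I D := by
    have h := cfg₆.sandwich 1 1 v₇ v₇' (Matrix.one_mul 1) (Matrix.one_mul 1) hv₇' hv₇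
    rwa [hS, map_sandwichEquiv_topZero 1 1 v₇ v₇' _ _ hv₇' hv₇ (isTopBlock_one q)] at h
  have hP7D : ∀ i ∈ D, β₇.w i j0 j1 = 0 := by
    intro i hi
    have hj1' : j1 = blkEmb 1 (n - 1) h1n ⟨0, by omega⟩ := Fin.ext (by simp [hj1])
    rw [hw₇, hj1', mul_blockEmbed_apply_blk 1 (n - 1) h1n A₇ (β₆.w i) j0 ⟨0, by omega⟩]
    simp_rw [hA₇col]
    have := congrFun (LinearMap.mem_ker.1 hcv'T) ⟨i, hi⟩
    simpa [T₇] using this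
  have hspan₇ : ∀ z ∈ Submodule.span k (β₇.w '' ↑I), ∃ z₆ ∈ Submodule.span k (β₆.w '' ↑I), z = z₆ * v₇ := by
    intro z hz
    have : β₇.w = mulRightLin k v₇ ∘ β₆.w := funext fun ρ => by rw [Function.comp_apply, mulRightLin_apply, hw₇]
    rw [this, ← map_span_image] at hz
    obtain ⟨z₆, hz₆, rfl⟩ := hz
    exact ⟨z₆, hz₆, rfl⟩
  have hP7 : ∀ z ∈ Submodule.span k (β₇.w '' ↑I), z j0 j1 = 0 := by
    intro z hz
    rw [← cfg₇.sup_eq] at hz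
    obtain ⟨sS, hsS, wD, hwD, rfl⟩ := Submodule.mem_sup.1 hz
    rw [Matrix.add_apply, hSrow sS hsS, zero_add]
    refine Submodule.span_induction (p := fun z _ => z j0 j1 = 0) ?_ rfl ?_ ?_ hwD
    · rintro _ ⟨i, hi, rfl⟩; exact hP7D i hi
    · intro y y' _ _ hy hy'; simp [Matrix.add_apply, hy, hy']
    · intro a y _ hy; simp [hy]
  have hc₇ : colMap k j0 ∘ β₇.w = c₆ := funext fun ρ => by
    simp only [Function.comp_apply, hc₆, hw₇, colMap_mul_of_fixesCols hv₇fix j0 (by simp [hj0])]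
  have hli₇ : LinearIndepOn k (colMap k j0 ∘ β₇.w) ↑(J₁ ∪ H₁) := by rw [hc₇]; exact hli₆
  have hJ₁span₇ : ∀ i ∈ I, colMap k j0 (β₇.w i) ∈ Submodule.span k ((colMap k j0 ∘ β₇.w) '' ↑J₁) := by
    intro i hi
    rw [hc₇]
    have : colMap k j0 (β₇.w i) = c₆ i := congrFun hc₇ i
    rw [this]; exact hJ₁span₆ i hi
  have hP5₇ : ∀ z ∈ Submodule.span k (β₇.w '' ↑I), z j0 j0 = 0 := by
    intro z hz
    obtain ⟨z₆, hz₆, rfl⟩ := hspan₇ z hz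
    rw [mul_apply_of_fixesCols hv₇fix z₆ j0 j0 (by simp [hj0])]
    exact hP5₆ z₆ hz₆
  have hP6₇ : ∀ ρ ∈ H₁, β₇.w ρ j0 j0 = 0 := fun ρ hρ => by
    rw [hw₇, mul_apply_of_fixesCols hv₇fix _ j0 j0 (by simp [hj0])]; exact hP6 ρ hρ
  exact caseA_core hn hnm hcard β₇ I D J₁ H₁ q hq2 cfg₇ hJ₁I hH₁I hJH hli₇ hJ₁span₇ hP5₇ hP6₇ hP7

end CaseA

end Literature.Computability.AlgebraicComplexity

namespace Literature.Computability.AlgebraicComplexity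

open Module Matrix

/-! ## Theorem 14 and Corollary 9 -/

section Assembly

/-- **Bläser 2003, Theorem 14, over an algebraically closed field**: there is no bilinear
computation of `⟨n,m,n⟩` (`m ≥ n ≥ 3`) of length `2mn + 2n − m − 3` (Lemma 7, the configuration
(3)–(4), and the two cases `rk a ≥ 2`, `rk a = 1`). [cite: Blaser2003, Theorem 14] -/
theorem not_bilinComp_short {k : Type*} [Field k] [IsAlgClosed k] {m n : ℕ} (hn : 3 ≤ n)
    (hnm : n ≤ m) {ι : Type*} [Fintype ι] [DecidableEq ι]
    (hcard : Fintype.card ι = 2 * (m * n) + 2 * n - m - 3) (β : BilinComp (mulBilin k n m n) ι) :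
    False := by
  obtain ⟨β', I, D, α, hα1, hαn, cfg⟩ := exists_config hn hnm hcard β
  by_cases hα : α = 1
  · subst hα
    have cfgT := cfg.transposed
    rw [map_transpose_topZero] at cfgT
    exact caseB_false hn hcard β'.transposed I D cfgT
  · exact caseA_false hn hnm hcard β' I D (n - α) (by omega) (by omega) cfg

/-- **Bläser 2003, Theorem 14** (discharge of the named fact `blaser2003_thm14`): for every field
`k` and all `m ≥ n ≥ 3`, `R(⟨n,m,n⟩) ≥ 2mn + 2n − m − 2`. By base change
(`tensorRank_matMulTensor_map_le`) it suffices to treat the algebraic closure; there a computation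
of length `2mn + 2n − m − 3` would exist (`exists_bilinComp_of_tensorRank_le`), contradicting
`not_bilinComp_short`. [cite: Blaser2003, Theorem 14] -/
theorem blaser2003_thm14_holds : blaser2003_thm14 := by
  intro K _ m n hn hnm
  have hclosed : 2 * m * n + 2 * n - m - 2 ≤
      tensorRank (matMulTensor (AlgebraicClosure K) n m n) := by
    by_contra hlt
    push Not at hlt
    have hmul : 2 * m * n = 2 * (m * n) := by ring
    have hle : tensorRank (matMulTensor (AlgebraicClosure K) n m n) ≤ 2 * (m * n) + 2 * n - m - 3 := by
      omega
    obtain ⟨β⟩ := exists_bilinComp_of_tensorRank_le hle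
    exact not_bilinComp_short (k := AlgebraicClosure K) hn hnm (by simp) β
  exact hclosed.trans (tensorRank_matMulTensor_map_le (algebraMap K (AlgebraicClosure K)) n m n)

/-- **Bläser 2003, Corollary 9** (discharge of the named fact `blaser2003_cor9`): over every field,
`R(⟨3,3,3⟩) ≥ 19` — Theorem 14 at `m = n = 3`. [cite: Blaser2003, Corollary 9] -/
theorem blaser2003_cor9_holds : blaser2003_cor9 :=
  blaser2003_cor9_of_thm14 blaser2003_thm14_holds

end Assembly

end Literature.Computability.AlgebraicComplexity
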